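import Literature.Analysis.FluidPDE.JiaSverak2013Lemma8WindowTools
import HarnessLib

/-!
# Jia–Šverák's Lemma 8, step 2: bounds for the windowed energy inequality of `w = v - e^{tΔ}v₀`

Analysis/FluidPDE proof file (theorems only, no definitions, no named facts), continuing
`JiaSverak2013Lemma8Window.lean` towards the discharge of the named fact
`Literature.Analysis.FluidPDE.jia_sverak_2013_lemma_8` (Jia–Šverák 2013, Lemma 8).

With the spatial weight `θ = χ²`, `χ(x) = cutoff 1 (x - x₀)` (`= 1` on `B̄(x₀,1)`, supported in
`B̄(x₀,2) ⊂ B(x₀,3)`), the windowed inequality `IsLocalLeraySolutionOn.windowed_remainder_inequality`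
is turned into an inequality between real numbers (`IsLocalLeraySolutionOn.windowed_energy_bound`):

  `∫ ρ⁻ Y ≤ ∫ ρ⁺ Y + ∫ σ (k Y) + ∫_{(δ/2, τ) × B(x₀,3)} Ψ`,

where `σ = timePlateau δ τ`, `σ' = ρ⁺ - ρ⁻` (rising and falling edge kernels),
`Y(t) = ∫ θ|v(t) - e(t)|²`, `k(t) = 1 + K₀ ‖e(t)‖₅⁵`, and `Ψ ≥ 0` is the explicit majorant
`c_Δ|w|² + 2c₁(|w|² + |e|²)|v| + 4c₁|π||w| + 2|De||e||w| + 2c₁|e|²|w| + 2c₁|e|³ + 4c₁|e||w|² + c₁²|w|²`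
of the lower-order terms (`w = v - e`, `e = e^{tΔ}v₀`, `c₁` a bound for `‖Dχ‖`, `c_Δ` for `|Δθ|`).
The two steps beyond book-keeping are the slice-wise integration by parts of the critical coupling
`∫ θ⟪De(w), w⟫ = -∫ (Dθ w)(e·w) - ∫ θ⟪(G - De)(w), e⟫` (`setIntegral_mul_inner_fderiv_apply_self_eq`,
at the good slices of the local Leray solution) and the trilinear bound
`two_mul_abs_integral_sq_mul_inner_apply_le` (`JiaSverak2013Lemma8SliceTools.lean`), whose
dissipation term is absorbed by the left-hand side.

## References

* H. Jia, V. Šverák, SIAM J. Math. Anal. 45 (2013) 1448–1459 = arXiv:1201.1592, Lemma 8 (p. 7).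
  [JiaSverak2013]
* G. Seregin, V. Šverák, Nonlinear Anal. 154 (2017) 269–296 = arXiv:1601.03096, §1 (1.7).
  [SereginSverak2017]
* P. G. Lemarié-Rieusset, *The Navier–Stokes problem in the 21st century* (2016), Thm. 14.7,
  proof pp. 515–518. [LemarieRieusset2016]
-/

noncomputable section

open MeasureTheory TopologicalSpace Set Function Filter Metric InnerProductSpace
open _root_.Topology
open scoped ENNReal NNReal RealInnerProductSpace Laplacian

namespace Literature.Analysis.FluidPDE

open FunctionSpaces

/-- Young's inequality `a² b ≤ (2a³ + b³)/3` for `a, b ≥ 0`. [folklore] -/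
private theorem sq_mul_le_two_cube_add_cube' {a b : ℝ} (ha : 0 ≤ a) (hb : 0 ≤ b) :
    a ^ 2 * b ≤ (2 * a ^ 3 + b ^ 3) / 3 := by
  nlinarith [sq_nonneg (a - b), mul_nonneg (mul_nonneg ha ha) hb, mul_nonneg ha hb,
    mul_nonneg (sq_nonneg (a - b)) (add_nonneg (mul_nonneg two_pos.le ha) hb)]

/-- `‖a - b‖ₑ² ≤ 2‖a‖ₑ² + 2‖b‖ₑ²` in `ℝ≥0∞`; private copy of
`Literature.Analysis.FluidPDE.enorm_sub_sq_le_two_mul` (`NSHopfLimit.lean`), kept local to avoid the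
periodic/Galerkin import closure. [folklore] -/
private theorem enorm_sub_sq_le_two {F : Type*} [NormedAddCommGroup F] (a b : F) :
    ‖a - b‖ₑ ^ 2 ≤ 2 * ‖a‖ₑ ^ 2 + 2 * ‖b‖ₑ ^ 2 := by
  have h : ‖a - b‖ ^ 2 ≤ 2 * ‖a‖ ^ 2 + 2 * ‖b‖ ^ 2 := by
    nlinarith [norm_sub_le a b, sq_nonneg (‖a‖ - ‖b‖), norm_nonneg (a - b), norm_nonneg a, norm_nonneg b]
  calc ‖a - b‖ₑ ^ 2 = ENNReal.ofReal (‖a - b‖ ^ 2) := by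
        rw [← ofReal_norm, ENNReal.ofReal_pow (norm_nonneg _)]
    _ ≤ ENNReal.ofReal (2 * ‖a‖ ^ 2 + 2 * ‖b‖ ^ 2) := ENNReal.ofReal_le_ofReal h
    _ = 2 * ‖a‖ₑ ^ 2 + 2 * ‖b‖ₑ ^ 2 := by
        rw [ENNReal.ofReal_add (by positivity) (by positivity), ENNReal.ofReal_mul zero_le_two,
          ENNReal.ofReal_mul zero_le_two, ENNReal.ofReal_pow (norm_nonneg _),
          ENNReal.ofReal_pow (norm_nonneg _), ofReal_norm, ofReal_norm, ENNReal.ofReal_ofNat]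

/-! ## The windowed energy bound -/

namespace IsLocalLeraySolutionOn

variable {T : ℝ} {v₀ : EuclideanSpace ℝ (Fin 3) → EuclideanSpace ℝ (Fin 3)}
  {v : ℝ → EuclideanSpace ℝ (Fin 3) → EuclideanSpace ℝ (Fin 3)}
  {π : ℝ → EuclideanSpace ℝ (Fin 3) → ℝ}

set_option maxHeartbeats 12800000 in
/-- **The windowed energy bound for `w = v - e^{tΔ}v₀`** (Jia–Šverák 2013, proof of Lemma 8,
"local energy estimates for `w`"; Seregin–Šverák 2017, proof of (1.7); Lemarié-Rieusset 2016,
proof of Thm. 14.7, pp. 516–518). Let `(v, π)` be a local Leray solution on `(0,T) × ℝ³`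
(unit viscosity) with datum `v₀ ∈ L³`, weakly divergence free, and let `G` be a weak spatial
gradient of `v` on the slab carrying the local energy inequality. Let `c₁, c_Δ` bound the
gradient of the translated cut-offs `χ = cutoff 1 (· - x₀)` and the Laplacian of `θ = χ²`
(`exists_cutoff_translate_bounds`), and let `K₀` be the constant of the trilinear bound on balls
of radius `3` (`two_mul_abs_integral_sq_mul_inner_apply_le 3`). Then for every centre `x₀` and
every window `0 < δ`, `4δ ≤ τ < T`, with `σ = timePlateau δ τ`, `e(t) = e^{tΔ}v₀`,
`w = v - e`, `Y(t) = ∫ θ|w(t)|²`, `P(t) = ‖e(t)‖₅⁵`: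
`∫ ρ⁻ Y ≤ ∫ ρ⁺ Y + ∫ σ Y + K₀ ∫⁻ σ P Y + ∫_{(δ/2,τ) × B(x₀,3)} Ψ`, `Ψ` the explicit nonnegative
majorant of the statement (`ρ^± ` the edge kernels of `σ' = ρ⁺ - ρ⁻`).
[cite: JiaSverak2013, Lemma 8, proof (arXiv:1201.1592 p. 7)] [cite: SereginSverak2017, §1 (1.7), proof] [cite: LemarieRieusset2016, Thm. 14.7 proof (pp. 516–518)] -/
theorem windowed_energy_bound (h : IsLocalLeraySolutionOn T 1 v₀ v π)
    (hv₀ : MemLp v₀ 3 volume) (hdiv₀ : IsWeaklyDivFree v₀)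
    {G : ℝ → EuclideanSpace ℝ (Fin 3) → EuclideanSpace ℝ (Fin 3) →L[ℝ] EuclideanSpace ℝ (Fin 3)}
    (hG : HasWeakSpatialGradientOn (slab (EuclideanSpace ℝ (Fin 3)) (Ioo 0 T) isOpen_Ioo) v G)
    (hG2 : ∀ K ⊆ ((slab (EuclideanSpace ℝ (Fin 3)) (Ioo 0 T) isOpen_Ioo :
      Opens (ℝ × EuclideanSpace ℝ (Fin 3))) : Set (ℝ × EuclideanSpace ℝ (Fin 3))), IsCompact K →
      ∫⁻ z in K, ENNReal.ofReal (frobeniusNormSq (G z.1 z.2)) < ∞)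
    (hLEI : ∀ φ : ℝ → EuclideanSpace ℝ (Fin 3) → ℝ,
      IsSpaceTimeTestOn (slab (EuclideanSpace ℝ (Fin 3)) (Ioo 0 T) isOpen_Ioo) φ → (∀ t x, 0 ≤ φ t x) →
      2 * (1 : ℝ) * ∫ t, ∫ x, frobeniusNormSq (G t x) * φ t x ≤
        ∫ t, ∫ x, (‖v t x‖ ^ 2 * (timeDeriv φ t x + 1 * Δ (φ t) x) +
          (‖v t x‖ ^ 2 + 2 * π t x) * ⟪v t x, gradient (φ t) x⟫ +
          2 * ⟪(0 : ℝ → EuclideanSpace ℝ (Fin 3) → EuclideanSpace ℝ (Fin 3)) t x, v t x⟫ * φ t x))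
    {c₁ cΔ K₀ : ℝ} (hc₁ : 0 ≤ c₁) (hK₀ : 0 ≤ K₀)
    (hcut : ∀ x₀ x : EuclideanSpace ℝ (Fin 3),
      ‖fderiv ℝ (fun y => cutoff (1 : ℝ) (y - x₀)) x‖ ≤ c₁ ∧
      |(Δ (fun y => cutoff (1 : ℝ) (y - x₀) ^ 2)) x| ≤ cΔ)
    (htri : ∀ (x₀ : EuclideanSpace ℝ (Fin 3)) (w : EuclideanSpace ℝ (Fin 3) → EuclideanSpace ℝ (Fin 3))
      (g : EuclideanSpace ℝ (Fin 3) → EuclideanSpace ℝ (Fin 3) →L[ℝ] EuclideanSpace ℝ (Fin 3))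
      (χ : EuclideanSpace ℝ (Fin 3) → ℝ) (c : ℝ) (ε : EuclideanSpace ℝ (Fin 3) → EuclideanSpace ℝ (Fin 3)),
      HasWeakFDerivOn (⟨ball x₀ 3, isOpen_ball⟩ : Opens (EuclideanSpace ℝ (Fin 3))) volume w g →
      ∫⁻ x in ball x₀ 3, ‖w x‖ₑ ^ 2 < ∞ →
      ∫⁻ x in ball x₀ 3, ENNReal.ofReal (frobeniusNormSq (g x)) < ∞ →
      ContDiff ℝ (⊤ : ℕ∞) χ → tsupport χ ⊆ ball x₀ 3 → (∀ x, |χ x| ≤ 1) → 0 ≤ c →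
      (∀ x, ‖fderiv ℝ χ x‖ ≤ c) → Continuous ε → eLpNorm ε 5 volume < ∞ →
      2 * |∫ x, χ x ^ 2 * ⟪g x (w x), ε x⟫| ≤
        (∫ x, χ x ^ 2 * frobeniusNormSq (g x)) + (∫ x, χ x ^ 2 * ‖w x‖ ^ 2) +
          c ^ 2 * (∫ x in ball x₀ 3, ‖w x‖ ^ 2) +
          K₀ * (eLpNorm ε 5 volume).toReal ^ 5 * ∫ x, χ x ^ 2 * ‖w x‖ ^ 2)
    (x₀ : EuclideanSpace ℝ (Fin 3)) {δ τ : ℝ} (hδ : 0 < δ) (hδτ : 4 * δ ≤ τ) (hτT : τ < T) :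
    ∫ t, ((1 / δ) * deriv Real.smoothTransition ((τ - δ - t) / δ)) *
        ∫ x, cutoff (1 : ℝ) (x - x₀) ^ 2 * ‖v t x - heatFlow v₀ (1 * t) x‖ ^ 2 ≤
      (∫ t, ((1 / δ) * deriv Real.smoothTransition ((t - δ) / δ)) *
        ∫ x, cutoff (1 : ℝ) (x - x₀) ^ 2 * ‖v t x - heatFlow v₀ (1 * t) x‖ ^ 2) +
      (∫ t, timePlateau δ τ t *
        ∫ x, cutoff (1 : ℝ) (x - x₀) ^ 2 * ‖v t x - heatFlow v₀ (1 * t) x‖ ^ 2) +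
      K₀ * (∫⁻ t, ENNReal.ofReal (timePlateau δ τ t *
        ((eLpNorm (heatFlow v₀ (1 * t)) 5 volume).toReal ^ 5 *
          ∫ x, cutoff (1 : ℝ) (x - x₀) ^ 2 * ‖v t x - heatFlow v₀ (1 * t) x‖ ^ 2))).toReal +
      ∫ z in Ioo (δ / 2) τ ×ˢ ball x₀ 3,
        (cΔ * ‖v z.1 z.2 - heatFlow v₀ (1 * z.1) z.2‖ ^ 2 +
          2 * c₁ * ((‖v z.1 z.2 - heatFlow v₀ (1 * z.1) z.2‖ ^ 2 + ‖heatFlow v₀ (1 * z.1) z.2‖ ^ 2) *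
            ‖v z.1 z.2‖) +
          4 * c₁ * (|π z.1 z.2| * ‖v z.1 z.2 - heatFlow v₀ (1 * z.1) z.2‖) +
          2 * (‖fderiv ℝ (heatFlow v₀ (1 * z.1)) z.2‖ * ‖heatFlow v₀ (1 * z.1) z.2‖ *
            ‖v z.1 z.2 - heatFlow v₀ (1 * z.1) z.2‖) +
          2 * c₁ * (‖heatFlow v₀ (1 * z.1) z.2‖ ^ 2 * ‖v z.1 z.2 - heatFlow v₀ (1 * z.1) z.2‖) +
          2 * c₁ * ‖heatFlow v₀ (1 * z.1) z.2‖ ^ 3 +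
          4 * c₁ * (‖heatFlow v₀ (1 * z.1) z.2‖ * ‖v z.1 z.2 - heatFlow v₀ (1 * z.1) z.2‖ ^ 2) +
          c₁ ^ 2 * ‖v z.1 z.2 - heatFlow v₀ (1 * z.1) z.2‖ ^ 2) := by
  have hν : (0 : ℝ) < 1 := one_pos
  have hT : 0 < T := by linarith
  -- ### §0 the objects
  set χ : EuclideanSpace ℝ (Fin 3) → ℝ := fun x => cutoff (1 : ℝ) (x - x₀) with hχdef
  set θ : EuclideanSpace ℝ (Fin 3) → ℝ := fun x => cutoff (1 : ℝ) (x - x₀) ^ 2 with hθdef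
  set e : ℝ → EuclideanSpace ℝ (Fin 3) → EuclideanSpace ℝ (Fin 3) := fun t x => heatFlow v₀ (1 * t) x with hedef
  set σ : ℝ → ℝ := timePlateau δ τ with hσdef
  obtain ⟨rise, hrise⟩ : ∃ f : ℝ → ℝ, f = fun t => (1 / δ) * deriv Real.smoothTransition ((t - δ) / δ) := ⟨_, rfl⟩
  obtain ⟨fall, hfall⟩ : ∃ f : ℝ → ℝ, f = fun t => (1 / δ) * deriv Real.smoothTransition ((τ - δ - t) / δ) := ⟨_, rfl⟩
  set B : Set (EuclideanSpace ℝ (Fin 3)) := ball x₀ 3 with hBdef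
  have hBm : MeasurableSet B := measurableSet_ball
  set S : Set (ℝ × EuclideanSpace ℝ (Fin 3)) := Ioo (δ / 2) τ ×ˢ B with hSdef
  have hSm : MeasurableSet S := measurableSet_Ioo.prod hBm
  -- rewrite the goal in terms of the abbreviations
  have he_app : ∀ t, heatFlow v₀ (1 * t) = e t := fun t => rfl
  have hθ_app : ∀ x, cutoff (1 : ℝ) (x - x₀) ^ 2 = θ x := fun x => rfl
  have hrise_app : ∀ t, (1 / δ) * deriv Real.smoothTransition ((t - δ) / δ) = rise t := fun t => by rw [hrise]
  have hfall_app : ∀ t, (1 / δ) * deriv Real.smoothTransition ((τ - δ - t) / δ) = fall t := fun t => by rw [hfall]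
  simp only [he_app, hθ_app, hrise_app, hfall_app]
  set Y : ℝ → ℝ := fun t => ∫ x, θ x * ‖v t x - e t x‖ ^ 2 with hYdef
  have hY_app : ∀ t, (∫ x, θ x * ‖v t x - e t x‖ ^ 2) = Y t := fun t => rfl
  simp only [hY_app]
  -- ### §1 the cut-offs
  have hχs : ContDiff ℝ (⊤ : ℕ∞) χ := (contDiff_cutoff 1).comp (contDiff_id.sub contDiff_const)
  have hχ1 : ∀ x, |χ x| ≤ 1 := fun x => abs_cutoff_le_one 1 _
  have hχsupp : support χ ⊆ ball x₀ 2 := by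
    intro x hx
    rw [mem_support] at hx
    rw [mem_ball, dist_eq_norm]
    by_contra hc
    exact hx (cutoff_eq_zero one_pos (by linarith [not_lt.1 hc]))
  have hχts : tsupport χ ⊆ closedBall x₀ 2 :=
    (closure_mono hχsupp).trans (closure_ball_subset_closedBall)
  have hχc : HasCompactSupport χ :=
    HasCompactSupport.of_support_subset_isCompact (isCompact_closedBall x₀ 2)
      (hχsupp.trans ball_subset_closedBall)
  have hχB : tsupport χ ⊆ B := hχts.trans (closedBall_subset_ball (by norm_num))
  have hθχ : ∀ x, θ x = χ x ^ 2 := fun x => rfl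
  have hθs : ContDiff ℝ (⊤ : ℕ∞) θ := hχs.pow 2
  have hθsupp : support θ ⊆ support χ := fun x hx => by
    rw [mem_support] at hx ⊢
    exact fun h0 => hx (by rw [hθχ, h0]; ring)
  have hθts : tsupport θ ⊆ closedBall x₀ 2 := (closure_mono hθsupp).trans hχts
  have hθc : HasCompactSupport θ :=
    HasCompactSupport.of_support_subset_isCompact (isCompact_closedBall x₀ 2)
      ((hθsupp.trans hχsupp).trans ball_subset_closedBall)
  have hθB : tsupport θ ⊆ B := hθts.trans (closedBall_subset_ball (by norm_num))
  have hθ0 : ∀ x, 0 ≤ θ x := fun x => sq_nonneg _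
  have hθ1 : ∀ x, θ x ≤ 1 := fun x => by
    rw [hθχ, ← sq_abs]; have := hχ1 x; nlinarith [abs_nonneg (χ x)]
  have hθabs : ∀ x, |θ x| ≤ 1 := fun x => by rw [abs_of_nonneg (hθ0 x)]; exact hθ1 x
  have hDχ : ∀ x, ‖fderiv ℝ χ x‖ ≤ c₁ := fun x => (hcut x₀ x).1
  have hΔθ : ∀ x, |(Δ θ) x| ≤ cΔ := fun x => (hcut x₀ x).2
  have hχd : Differentiable ℝ χ := hχs.differentiable (by simp)
  have hDθ_eq : ∀ x, fderiv ℝ θ x = (2 * χ x) • fderiv ℝ χ x := fun x => by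
    have : θ = fun y => χ y * χ y := funext fun y => by rw [hθχ]; ring
    rw [this, fderiv_fun_mul (hχd x) (hχd x)]; rw [two_mul, add_smul]
  have hDθ : ∀ x, ‖fderiv ℝ θ x‖ ≤ 2 * c₁ := fun x => by
    rw [hDθ_eq, norm_smul, Real.norm_eq_abs, abs_mul, abs_two]
    calc 2 * |χ x| * ‖fderiv ℝ χ x‖ ≤ 2 * 1 * c₁ := by
          gcongr
          · exact hχ1 x
          · exact hDχ x
      _ = 2 * c₁ := by ring
  have hgradθ : ∀ x (u : EuclideanSpace ℝ (Fin 3)), |⟪u, gradient θ x⟫| ≤ 2 * c₁ * ‖u‖ := by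
    intro x u
    rw [gradient, real_inner_comm, InnerProductSpace.toDual_symm_apply]
    calc |fderiv ℝ θ x u| = ‖fderiv ℝ θ x u‖ := (Real.norm_eq_abs _).symm
      _ ≤ ‖fderiv ℝ θ x‖ * ‖u‖ := ContinuousLinearMap.le_opNorm _ _
      _ ≤ 2 * c₁ * ‖u‖ := mul_le_mul_of_nonneg_right (hDθ x) (norm_nonneg _)
  -- vanishing off the supports
  have hθz : ∀ x, x ∉ closedBall x₀ 2 → θ x = 0 := fun x hx =>
    image_eq_zero_of_notMem_tsupport fun h' => hx (hθts h')
  have hgθz : ∀ x, x ∉ closedBall x₀ 2 → gradient θ x = 0 := fun x hx => by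
    have : fderiv ℝ θ x = 0 := image_eq_zero_of_notMem_tsupport fun h' =>
      hx (hθts (tsupport_fderiv_subset ℝ h'))
    rw [gradient, this, map_zero]
  have hΔθz : ∀ x, x ∉ closedBall x₀ 2 → (Δ θ) x = 0 := fun x hx =>
    laplacian_eq_zero_of_notMem_tsupport fun h' => hx (hθts h')
  -- the window
  have hσ_nn : ∀ t, 0 ≤ σ t := fun t => timePlateau_nonneg δ τ t
  have hσ_le : ∀ t, σ t ≤ 1 := fun t => timePlateau_le_one δ τ t
  have hσz : ∀ t, t ∉ Ioo δ (τ - δ) → σ t = 0 := fun t ht => timePlateau_eq_zero_of_notMem hδ ht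
  have hσ'z : ∀ t, t ∉ Ioo δ (τ - δ) → deriv σ t = 0 := fun t ht =>
    deriv_timePlateau_eq_zero_of_notMem hδ ht
  have hσ' : ∀ t, deriv σ t = rise t - fall t := fun t => by
    rw [hrise, hfall]; exact deriv_timePlateau_eq_rise_sub_fall hδ hδτ t
  have hσc : Continuous σ := (contDiff_timePlateau δ τ (n := 0)).continuous
  have hσ'c : Continuous (deriv σ) := continuous_deriv_timePlateau δ τ
  -- ### §2 the windowed inequality
  have h5 := h.windowed_remainder_inequality hv₀ hdiv₀ hG hG2 hLEI hθs hθc hθ0 hδ hτT (τ := τ)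
  simp only [he_app] at h5
  -- ### §3 the compact carrier `K` of all integrands, the cylinder `S ⊆ K₂`
  set K : Set (ℝ × EuclideanSpace ℝ (Fin 3)) := Icc δ (τ - δ) ×ˢ closedBall x₀ 3 with hKdef
  have hKc : IsCompact K := isCompact_Icc.prod (isCompact_closedBall _ _)
  have hKm : MeasurableSet K := hKc.measurableSet
  set K₂ : Set (ℝ × EuclideanSpace ℝ (Fin 3)) := Icc (δ / 2) τ ×ˢ closedBall x₀ 3 with hK₂def
  have hK₂c : IsCompact K₂ := isCompact_Icc.prod (isCompact_closedBall _ _)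
  have hK₂m : MeasurableSet K₂ := hK₂c.measurableSet
  have hKK₂ : K ⊆ K₂ := Set.prod_mono (Icc_subset_Icc (by linarith) (by linarith)) Subset.rfl
  have hSK₂ : S ⊆ K₂ := Set.prod_mono Ioo_subset_Icc_self ball_subset_closedBall
  have hK₂slab : K₂ ⊆ ((slab (EuclideanSpace ℝ (Fin 3)) (Ioo 0 T) isOpen_Ioo :
      Opens (ℝ × EuclideanSpace ℝ (Fin 3))) : Set (ℝ × EuclideanSpace ℝ (Fin 3))) := fun z hz =>
    mem_slab.2 ⟨by linarith [hz.1.1], by linarith [hz.1.2]⟩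
  have hKslab := hKK₂.trans hK₂slab
  have hK₂cyl : K₂ ⊆ Ioo 0 T ×ˢ closedBall x₀ 3 := Set.prod_mono
    (fun t ht => ⟨by linarith [ht.1], by linarith [ht.2]⟩) Subset.rfl
  have hScyl : S ⊆ Ioo 0 T ×ˢ closedBall x₀ 3 := hSK₂.trans hK₂cyl
  haveI hKfin : IsFiniteMeasure (volume.restrict K) := ⟨by
    rw [Measure.restrict_apply_univ]; exact hKc.measure_lt_top⟩
  haveI hSfin : IsFiniteMeasure (volume.restrict S) := ⟨by
    rw [Measure.restrict_apply_univ]; exact (measure_mono hSK₂).trans_lt hK₂c.measure_lt_top⟩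
  -- off `K`, one of the weights vanishes
  have hvan : ∀ z : ℝ × EuclideanSpace ℝ (Fin 3), z ∉ K →
      (σ z.1 = 0 ∧ deriv σ z.1 = 0) ∨ (θ z.2 = 0 ∧ gradient θ z.2 = 0 ∧ (Δ θ) z.2 = 0) := by
    intro z hz
    by_cases h1 : z.1 ∈ Icc δ (τ - δ)
    · have h2 : z.2 ∉ closedBall x₀ 3 := fun h2 => hz ⟨h1, h2⟩
      have h2' : z.2 ∉ closedBall x₀ 2 := fun h' => h2 (closedBall_subset_closedBall (by norm_num) h')
      exact Or.inr ⟨hθz _ h2', hgθz _ h2', hΔθz _ h2'⟩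
    · have h1' : z.1 ∉ Ioo δ (τ - δ) := fun h' => h1 (Ioo_subset_Icc_self h')
      exact Or.inl ⟨hσz _ h1', hσ'z _ h1'⟩
  have hriseK : ∀ t, t ∉ Icc δ (τ - δ) → rise t = 0 := fun t ht => by
    rw [hrise]; exact plateauRise_eq_zero_of_notMem hδ fun h' => ht ⟨h'.1, by linarith [h'.2]⟩
  have hfallK : ∀ t, t ∉ Icc δ (τ - δ) → fall t = 0 := fun t ht => by
    rw [hfall]; exact plateauFall_eq_zero_of_notMem hδ fun h' => ht ⟨by linarith [h'.1], h'.2⟩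
  -- ### §4 the smooth cut-off caloric field `Ec` (`= e` for `t ≥ δ/2`) and bounds on `K₂`
  set Ec : ℝ → EuclideanSpace ℝ (Fin 3) → EuclideanSpace ℝ (Fin 3) :=
    fun t x => Real.smoothTransition (4 * t / δ - 1) • heatFlow v₀ (1 * t) x with hEc
  have hEcs : ContDiff ℝ (⊤ : ℕ∞) (uncurry Ec) := contDiff_uncurry_cutoffHeatFlow hv₀ (by norm_num) hν hδ
  have hEc_eq : ∀ t, δ / 2 ≤ t → Ec t = e t := fun t ht => funext fun x => cutoffHeatFlow_eq_of_le hδ ht x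
  have hes : IsSmoothSpaceTimeOn univ Ec := IsSmoothSpaceTimeOn.of_contDiff_univ hEcs
  have hEc_c : Continuous fun z : ℝ × EuclideanSpace ℝ (Fin 3) => Ec z.1 z.2 := hes.continuous_of_univ
  have hDEc_c : Continuous fun z : ℝ × EuclideanSpace ℝ (Fin 3) => fderiv ℝ (Ec z.1) z.2 :=
    (hes.fderiv_slice uniqueDiffOn_univ).continuous_of_univ
  have he1 : ∀ t, δ / 2 ≤ t → ContDiff ℝ (⊤ : ℕ∞) (e t) := fun t ht => by
    rw [← hEc_eq t ht]; exact contDiff_slice_field hEcs t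
  have hediv : ∀ t, δ / 2 ≤ t → VectorCalculus.IsDivFree (e t) := fun t ht => by
    rw [← hEc_eq t ht]; exact isDivFree_cutoffHeatFlow hdiv₀ hv₀ (by norm_num) hν hδ t
  have heK₂ : ∀ z ∈ K₂, e z.1 z.2 = Ec z.1 z.2 := fun z hz => by rw [hEc_eq z.1 hz.1.1]
  have hDeK₂ : ∀ z ∈ K₂, fderiv ℝ (e z.1) z.2 = fderiv ℝ (Ec z.1) z.2 := fun z hz => by
    rw [hEc_eq z.1 hz.1.1]
  obtain ⟨Ce, hCe0, hCe⟩ := exists_forall_mem_norm_le_of_continuous hK₂c hEc_c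
  obtain ⟨CDe, hCDe0, hCDe⟩ := exists_forall_mem_norm_le_of_continuous hK₂c hDEc_c
  have heb : ∀ z ∈ K₂, ‖e z.1 z.2‖ ≤ Ce := fun z hz => by rw [heK₂ z hz]; exact hCe z hz
  have hDeb : ∀ z ∈ K₂, ‖fderiv ℝ (e z.1) z.2‖ ≤ CDe := fun z hz => by rw [hDeK₂ z hz]; exact hCDe z hz
  -- `L⁵` bound of the slices on `[δ/2, ∞)`
  obtain ⟨C35, hC35⟩ := UnboundedOperators.eLpNorm_heatExtension_le_rpow_holds
    (E := EuclideanSpace ℝ (Fin 3)) (F := EuclideanSpace ℝ (Fin 3)) (p := 3) (q := 5) (by norm_num) (by norm_num)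
  have he5 : ∀ t, 0 < t → eLpNorm (e t) 5 volume < ∞ := by
    intro t ht
    have h1 := hC35 v₀ hv₀ (1 * t) (by linarith)
    have : e t = UnboundedOperators.heatExtension v₀ (1 * t) := by
      rw [hedef]; exact heatFlow_of_pos v₀ (by linarith)
    rw [this]
    exact lt_of_le_of_lt h1 (ENNReal.mul_lt_top (ENNReal.mul_lt_top (by simp) ENNReal.ofReal_lt_top)
      hv₀.eLpNorm_lt_top)
  set P : ℝ → ℝ := fun t => (eLpNorm (e t) 5 volume).toReal ^ 5 with hPdef
  have hP0 : ∀ t, 0 ≤ P t := fun t => by positivity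
  obtain ⟨Pstar, hPstar0, hPstar⟩ : ∃ Pstar : ℝ, 0 ≤ Pstar ∧ ∀ t, δ / 2 ≤ t → P t ≤ Pstar := by
    refine ⟨((C35 : ℝ) * (δ / 2) ^ (-((3 : ℝ) / 2) * ((1 / (3 : ℝ≥0∞)).toReal - (1 / (5 : ℝ≥0∞)).toReal)) *
      (eLpNorm v₀ 3 volume).toReal) ^ 5, by positivity, fun t ht => ?_⟩
    have ht0 : 0 < t := by linarith
    have h1 := hC35 v₀ hv₀ (1 * t) (by linarith)
    have he_eq : e t = UnboundedOperators.heatExtension v₀ (1 * t) := by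
      rw [hedef]; exact heatFlow_of_pos v₀ (by linarith)
    rw [hPdef]; dsimp only
    refine pow_le_pow_left₀ ENNReal.toReal_nonneg ?_ 5
    have hfin : (C35 : ℝ≥0∞) * ENNReal.ofReal ((1 * t) ^ (-((Module.finrank ℝ (EuclideanSpace ℝ (Fin 3)) : ℝ) / 2) *
        ((1 / (3 : ℝ≥0∞)).toReal - (1 / (5 : ℝ≥0∞)).toReal))) * eLpNorm v₀ 3 volume ≠ ∞ :=
      ENNReal.mul_ne_top (ENNReal.mul_ne_top (by simp) ENNReal.ofReal_ne_top) hv₀.eLpNorm_ne_top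
    rw [he_eq]
    refine (ENNReal.toReal_mono hfin h1).trans ?_
    rw [ENNReal.toReal_mul, ENNReal.toReal_mul, ENNReal.toReal_ofReal (Real.rpow_nonneg (by linarith) _),
      finrank_euclideanSpace_fin]
    refine mul_le_mul_of_nonneg_right (mul_le_mul_of_nonneg_left ?_ (by simp)) ENNReal.toReal_nonneg
    -- the exponent is negative: the power is antitone in `t`
    have hexp : -((3 : ℝ) / 2) * ((1 / (3 : ℝ≥0∞)).toReal - (1 / (5 : ℝ≥0∞)).toReal) ≤ 0 := by
      have : 0 ≤ (1 / (3 : ℝ≥0∞)).toReal - (1 / (5 : ℝ≥0∞)).toReal := by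
        rw [ENNReal.toReal_div, ENNReal.toReal_div]; norm_num
      have h3 : -((3 : ℝ) / 2) ≤ 0 := by norm_num
      exact mul_nonpos_of_nonpos_of_nonneg h3 this
    push_cast
    rw [one_mul]
    exact Real.rpow_le_rpow_of_nonpos (by linarith) ht hexp
  -- ### §5 classes on `K₂` (hence on `K` and `S`)
  set cyl : Set (ℝ × EuclideanSpace ℝ (Fin 3)) := Ioo 0 T ×ˢ closedBall x₀ 3 with hcyl
  have hcylm : MeasurableSet cyl := measurableSet_Ioo.prod measurableSet_closedBall
  obtain ⟨hv1cyl, hv2cyl⟩ := h.integrableOn_velocity (isCompact_closedBall x₀ 3)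
  have hv3cyl := h.integrableOn_cube_cylinder (isCompact_closedBall x₀ 3)
  have hπcyl := h.integrableOn_pressure (isCompact_closedBall x₀ 3)
  have hπ32cyl := h.integrableOn_abs_pressure_rpow_cylinder (isCompact_closedBall x₀ 3)
  have hvm : AEStronglyMeasurable (uncurry v) (volume.restrict cyl) := hv1cyl.aestronglyMeasurable
  have hπm : AEStronglyMeasurable (uncurry π) (volume.restrict cyl) := hπcyl.aestronglyMeasurable
  -- `|π| |v|` on the cylinder (Young)
  have hπvcyl : IntegrableOn (fun z : ℝ × EuclideanSpace ℝ (Fin 3) => |π z.1 z.2| * ‖v z.1 z.2‖) cyl volume := by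
    refine Integrable.mono' ((hπ32cyl.const_mul (2 / 3)).add (hv3cyl.const_mul (1 / 3)))
      (hπm.norm.mul hvm.norm) (Eventually.of_forall fun z => ?_)
    have hpq : (3 / 2 : ℝ).HolderConjugate 3 := Real.holderConjugate_iff.2 ⟨by norm_num, by norm_num⟩
    have hy := Real.young_inequality_of_nonneg (abs_nonneg (π z.1 z.2)) (norm_nonneg (v z.1 z.2)) hpq
    have h3 : ‖v z.1 z.2‖ ^ (3 : ℝ) = ‖v z.1 z.2‖ ^ 3 := by
      rw [show (3 : ℝ) = ((3 : ℕ) : ℝ) by norm_num, Real.rpow_natCast]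
    rw [h3] at hy
    rw [Real.norm_eq_abs, abs_of_nonneg (by positivity)]
    simp only [Pi.add_apply]
    linarith
  -- the gradient on `K₂`
  have hGm₂ : AEStronglyMeasurable (fun z : ℝ × EuclideanSpace ℝ (Fin 3) => G z.1 z.2) (volume.restrict K₂) :=
    (hG.locallyIntegrableOn_grad.aestronglyMeasurable).mono_measure (Measure.restrict_mono hK₂slab le_rfl)
  have hfrob_c : Continuous fun L : EuclideanSpace ℝ (Fin 3) →L[ℝ] EuclideanSpace ℝ (Fin 3) => frobeniusNormSq L := by
    unfold frobeniusNormSq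
    exact continuous_finsetSum _ fun i _ =>
      ((ContinuousLinearMap.apply ℝ (EuclideanSpace ℝ (Fin 3)) (stdOrthonormalBasis ℝ (EuclideanSpace ℝ (Fin 3)) i)).continuous.norm).pow 2
  have gG2 : IntegrableOn (fun z : ℝ × EuclideanSpace ℝ (Fin 3) => frobeniusNormSq (G z.1 z.2)) K₂ volume := by
    refine ⟨hfrob_c.comp_aestronglyMeasurable hGm₂, ?_⟩
    rw [hasFiniteIntegral_iff_enorm]
    refine lt_of_le_of_lt (lintegral_mono fun z => le_of_eq ?_) (hG2 K₂ hK₂slab hK₂c)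
    rw [Real.enorm_eq_ofReal (frobeniusNormSq_nonneg _)]
  -- restrictions to `K₂`
  have hK₂cyl' : volume.restrict K₂ ≤ volume.restrict cyl := Measure.restrict_mono hK₂cyl le_rfl
  have gU1 : IntegrableOn (fun z : ℝ × EuclideanSpace ℝ (Fin 3) => ‖v z.1 z.2‖) K₂ volume :=
    Integrable.mono_measure hv1cyl.norm hK₂cyl'
  have gU2 : IntegrableOn (fun z : ℝ × EuclideanSpace ℝ (Fin 3) => ‖v z.1 z.2‖ ^ 2) K₂ volume :=
    Integrable.mono_measure hv2cyl hK₂cyl'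
  have gU3 : IntegrableOn (fun z : ℝ × EuclideanSpace ℝ (Fin 3) => ‖v z.1 z.2‖ ^ 3) K₂ volume :=
    Integrable.mono_measure hv3cyl hK₂cyl'
  have gP1 : IntegrableOn (fun z : ℝ × EuclideanSpace ℝ (Fin 3) => |π z.1 z.2|) K₂ volume := by
    have := Integrable.mono_measure hπcyl.norm hK₂cyl'
    refine this.congr (Eventually.of_forall fun z => ?_)
    show ‖uncurry π z‖ = |π z.1 z.2|
    rw [Real.norm_eq_abs]; rfl
  have gPU : IntegrableOn (fun z : ℝ × EuclideanSpace ℝ (Fin 3) => |π z.1 z.2| * ‖v z.1 z.2‖) K₂ volume :=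
    Integrable.mono_measure hπvcyl hK₂cyl'
  have hvm₂ : AEStronglyMeasurable (fun z : ℝ × EuclideanSpace ℝ (Fin 3) => v z.1 z.2) (volume.restrict K₂) :=
    hvm.mono_measure hK₂cyl'
  have hπm₂ : AEStronglyMeasurable (fun z : ℝ × EuclideanSpace ℝ (Fin 3) => π z.1 z.2) (volume.restrict K₂) :=
    hπm.mono_measure hK₂cyl'
  have hem₂ : AEStronglyMeasurable (fun z : ℝ × EuclideanSpace ℝ (Fin 3) => e z.1 z.2) (volume.restrict K₂) :=
    (hEc_c.aestronglyMeasurable).congr ((ae_restrict_iff' hK₂m).2 (Eventually.of_forall fun z hz =>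
      (heK₂ z hz).symm))
  have hDem₂ : AEStronglyMeasurable (fun z : ℝ × EuclideanSpace ℝ (Fin 3) => fderiv ℝ (e z.1) z.2)
      (volume.restrict K₂) :=
    (hDEc_c.aestronglyMeasurable).congr ((ae_restrict_iff' hK₂m).2 (Eventually.of_forall fun z hz =>
      (hDeK₂ z hz).symm))
  have hwm₂ : AEStronglyMeasurable (fun z : ℝ × EuclideanSpace ℝ (Fin 3) => v z.1 z.2 - e z.1 z.2)
      (volume.restrict K₂) := hvm₂.sub hem₂
  -- pointwise bounds on `K₂`
  have hw_le : ∀ z ∈ K₂, ‖v z.1 z.2 - e z.1 z.2‖ ≤ ‖v z.1 z.2‖ + Ce := fun z hz =>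
    (norm_sub_le _ _).trans (add_le_add le_rfl (heb z hz))
  have hw2_le : ∀ z ∈ K₂, ‖v z.1 z.2 - e z.1 z.2‖ ^ 2 ≤ 2 * ‖v z.1 z.2‖ ^ 2 + 2 * Ce ^ 2 := fun z hz => by
    have := hw_le z hz
    nlinarith [norm_nonneg (v z.1 z.2 - e z.1 z.2), norm_nonneg (v z.1 z.2), sq_nonneg (‖v z.1 z.2‖ - Ce)]
  have hw3_le : ∀ z ∈ K₂, ‖v z.1 z.2 - e z.1 z.2‖ ^ 3 ≤ 4 * ‖v z.1 z.2‖ ^ 3 + 4 * Ce ^ 3 := fun z hz => by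
    have h1 := hw_le z hz
    have h0 := norm_nonneg (v z.1 z.2 - e z.1 z.2)
    have hv0 := norm_nonneg (v z.1 z.2)
    have h2 : ‖v z.1 z.2 - e z.1 z.2‖ ^ 3 ≤ (‖v z.1 z.2‖ + Ce) ^ 3 := pow_le_pow_left₀ h0 h1 3
    nlinarith [sq_nonneg (‖v z.1 z.2‖ - Ce), mul_nonneg hv0 hCe0, mul_nonneg (mul_nonneg hv0 hCe0) (add_nonneg hv0 hCe0)]
  -- integrable majorants on `K₂`
  have gW2 : IntegrableOn (fun z : ℝ × EuclideanSpace ℝ (Fin 3) => ‖v z.1 z.2 - e z.1 z.2‖ ^ 2) K₂ volume :=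
    Integrable.mono' ((gU2.const_mul 2).add (integrableOn_const (C := 2 * Ce ^ 2)
      (hs := hK₂c.measure_lt_top.ne) |>.integrable)) (hwm₂.norm.pow 2)
      ((ae_restrict_iff' hK₂m).2 (Eventually.of_forall fun z hz => by
        rw [Real.norm_eq_abs, abs_of_nonneg (sq_nonneg ‖v z.1 z.2 - e z.1 z.2‖)]; exact hw2_le z hz))
  have gW1 : IntegrableOn (fun z : ℝ × EuclideanSpace ℝ (Fin 3) => ‖v z.1 z.2 - e z.1 z.2‖) K₂ volume :=
    Integrable.mono' (gU1.add (integrableOn_const (C := Ce) (hs := hK₂c.measure_lt_top.ne) |>.integrable))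
      hwm₂.norm ((ae_restrict_iff' hK₂m).2 (Eventually.of_forall fun z hz => by
        rw [norm_norm]; exact hw_le z hz))
  have gW3 : IntegrableOn (fun z : ℝ × EuclideanSpace ℝ (Fin 3) => ‖v z.1 z.2 - e z.1 z.2‖ ^ 3) K₂ volume :=
    Integrable.mono' ((gU3.const_mul 4).add (integrableOn_const (C := 4 * Ce ^ 3)
      (hs := hK₂c.measure_lt_top.ne) |>.integrable)) (hwm₂.norm.pow 3)
      ((ae_restrict_iff' hK₂m).2 (Eventually.of_forall fun z hz => by
        rw [Real.norm_eq_abs, abs_of_nonneg (pow_nonneg (norm_nonneg _) 3)]; exact hw3_le z hz))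
  have gW2U : IntegrableOn (fun z : ℝ × EuclideanSpace ℝ (Fin 3) => ‖v z.1 z.2 - e z.1 z.2‖ ^ 2 * ‖v z.1 z.2‖)
      K₂ volume := by
    -- `|w|²|v| ≤ (2/3)|w|³ + (1/3)|v|³`
    refine Integrable.mono' ((gW3.const_mul (2 / 3)).add (gU3.const_mul (1 / 3)))
      ((hwm₂.norm.pow 2).mul hvm₂.norm) (Eventually.of_forall fun z => ?_)
    rw [Real.norm_eq_abs, abs_of_nonneg (by positivity)]
    simp only [Pi.add_apply]
    have := sq_mul_le_two_cube_add_cube' (norm_nonneg (v z.1 z.2 - e z.1 z.2)) (norm_nonneg (v z.1 z.2))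
    linarith
  have gPW : IntegrableOn (fun z : ℝ × EuclideanSpace ℝ (Fin 3) => |π z.1 z.2| * ‖v z.1 z.2 - e z.1 z.2‖) K₂ volume := by
    refine Integrable.mono' (gPU.add (gP1.mul_const Ce)) (hπm₂.norm.mul hwm₂.norm |>.congr ?_)
      ((ae_restrict_iff' hK₂m).2 (Eventually.of_forall fun z hz => ?_))
    · exact Eventually.of_forall fun z => by simp [Real.norm_eq_abs]
    · rw [Real.norm_eq_abs, abs_of_nonneg (by positivity)]
      simp only [Pi.add_apply]
      calc |π z.1 z.2| * ‖v z.1 z.2 - e z.1 z.2‖ ≤ |π z.1 z.2| * (‖v z.1 z.2‖ + Ce) :=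
            mul_le_mul_of_nonneg_left (hw_le z hz) (abs_nonneg _)
        _ = |π z.1 z.2| * ‖v z.1 z.2‖ + |π z.1 z.2| * Ce := by ring
  -- ### §6 the space–time integrands (all supported in `K`) are integrable
  have gGw2 : IntegrableOn (fun z : ℝ × EuclideanSpace ℝ (Fin 3) =>
      frobeniusNormSq (G z.1 z.2 - fderiv ℝ (e z.1) z.2)) K₂ volume := by
    have h1 : IntegrableOn (fun z : ℝ × EuclideanSpace ℝ (Fin 3) =>
        2 * frobeniusNormSq (G z.1 z.2) + 2 * (3 * CDe ^ 2)) K₂ volume :=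
      (gG2.const_mul 2).add (integrableOn_const (hs := hK₂c.measure_lt_top.ne)).integrable
    refine Integrable.mono' h1 (hfrob_c.comp_aestronglyMeasurable (hGm₂.sub hDem₂))
      ((ae_restrict_iff' hK₂m).2 (Eventually.of_forall fun z hz => ?_))
    rw [Real.norm_eq_abs, abs_of_nonneg (frobeniusNormSq_nonneg _)]
    refine (frobeniusNormSq_add_le_two_mul (G z.1 z.2) (-fderiv ℝ (e z.1) z.2) |> fun h' => ?_)
    have e1 : G z.1 z.2 - fderiv ℝ (e z.1) z.2 = G z.1 z.2 + -fderiv ℝ (e z.1) z.2 := sub_eq_add_neg _ _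
    rw [e1]
    refine h'.trans ?_
    have h2 : frobeniusNormSq (-fderiv ℝ (e z.1) z.2) ≤ 3 * CDe ^ 2 := by
      have := frobeniusNormSq_le_three_mul (-fderiv ℝ (e z.1) z.2)
      rw [norm_neg] at this
      exact this.trans (by have := hDeb z hz; gcongr)
    linarith
  -- continuity of the weights
  have hθcont : Continuous θ := hθs.continuous
  have hgθc : Continuous (gradient θ) :=
    (InnerProductSpace.toDual ℝ (EuclideanSpace ℝ (Fin 3))).symm.continuous.comp (hθs.continuous_fderiv (by simp))
  have hΔθc : Continuous (Δ θ) := continuous_laplacian (contDiff_infty.1 hθs 2)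
  have hrise_c : Continuous rise := by rw [hrise]; exact continuous_plateauRise δ
  have hfall_c : Continuous fall := by rw [hfall]; exact continuous_plateauFall δ τ
  obtain ⟨Cr, hCr0, hCr⟩ := exists_forall_mem_norm_le_of_continuous hKc (hrise_c.comp continuous_fst)
  obtain ⟨Cf, hCf0, hCf⟩ := exists_forall_mem_norm_le_of_continuous hKc (hfall_c.comp continuous_fst)
  -- measurability of the building blocks on `K`
  have hKK₂' : volume.restrict K ≤ volume.restrict K₂ := Measure.restrict_mono hKK₂ le_rfl
  have mv : AEStronglyMeasurable (fun z : ℝ × EuclideanSpace ℝ (Fin 3) => v z.1 z.2) (volume.restrict K) :=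
    hvm₂.mono_measure hKK₂'
  have mπ : AEStronglyMeasurable (fun z : ℝ × EuclideanSpace ℝ (Fin 3) => π z.1 z.2) (volume.restrict K) :=
    hπm₂.mono_measure hKK₂'
  have me : AEStronglyMeasurable (fun z : ℝ × EuclideanSpace ℝ (Fin 3) => e z.1 z.2) (volume.restrict K) :=
    hem₂.mono_measure hKK₂'
  have mDe : AEStronglyMeasurable (fun z : ℝ × EuclideanSpace ℝ (Fin 3) => fderiv ℝ (e z.1) z.2) (volume.restrict K) :=
    hDem₂.mono_measure hKK₂'
  have mw : AEStronglyMeasurable (fun z : ℝ × EuclideanSpace ℝ (Fin 3) => v z.1 z.2 - e z.1 z.2) (volume.restrict K) :=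
    hwm₂.mono_measure hKK₂'
  have mG : AEStronglyMeasurable (fun z : ℝ × EuclideanSpace ℝ (Fin 3) => G z.1 z.2) (volume.restrict K) :=
    hGm₂.mono_measure hKK₂'
  have mσ : AEStronglyMeasurable (fun z : ℝ × EuclideanSpace ℝ (Fin 3) => σ z.1) (volume.restrict K) :=
    (hσc.comp continuous_fst).aestronglyMeasurable
  have mσ' : AEStronglyMeasurable (fun z : ℝ × EuclideanSpace ℝ (Fin 3) => deriv σ z.1) (volume.restrict K) :=
    (hσ'c.comp continuous_fst).aestronglyMeasurable
  have mrise : AEStronglyMeasurable (fun z : ℝ × EuclideanSpace ℝ (Fin 3) => rise z.1) (volume.restrict K) :=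
    (hrise_c.comp continuous_fst).aestronglyMeasurable
  have mfall : AEStronglyMeasurable (fun z : ℝ × EuclideanSpace ℝ (Fin 3) => fall z.1) (volume.restrict K) :=
    (hfall_c.comp continuous_fst).aestronglyMeasurable
  have mθ : AEStronglyMeasurable (fun z : ℝ × EuclideanSpace ℝ (Fin 3) => θ z.2) (volume.restrict K) :=
    (hθcont.comp continuous_snd).aestronglyMeasurable
  have mgθ : AEStronglyMeasurable (fun z : ℝ × EuclideanSpace ℝ (Fin 3) => gradient θ z.2) (volume.restrict K) :=
    (hgθc.comp continuous_snd).aestronglyMeasurable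
  have mΔθ : AEStronglyMeasurable (fun z : ℝ × EuclideanSpace ℝ (Fin 3) => (Δ θ) z.2) (volume.restrict K) :=
    (hΔθc.comp continuous_snd).aestronglyMeasurable
  have mB : AEStronglyMeasurable (fun z : ℝ × EuclideanSpace ℝ (Fin 3) => B.indicator (fun _ => (1 : ℝ)) z.2)
      (volume.restrict K) :=
    ((aestronglyMeasurable_const (b := (1 : ℝ))).indicator hBm).comp_snd.mono_measure Measure.restrict_le_self
  have mDew : AEStronglyMeasurable (fun z : ℝ × EuclideanSpace ℝ (Fin 3) =>
      fderiv ℝ (e z.1) z.2 (v z.1 z.2 - e z.1 z.2)) (volume.restrict K) := aestronglyMeasurable_clm_apply₂ mDe mw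
  have mDee : AEStronglyMeasurable (fun z : ℝ × EuclideanSpace ℝ (Fin 3) =>
      fderiv ℝ (e z.1) z.2 (e z.1 z.2)) (volume.restrict K) := aestronglyMeasurable_clm_apply₂ mDe me
  -- restrictions of the majorants to `K`
  have kW2 := gW2.mono_set hKK₂
  have kW1 := gW1.mono_set hKK₂
  have kW2U := gW2U.mono_set hKK₂
  have kPW := gPW.mono_set hKK₂
  have kU1 := gU1.mono_set hKK₂
  have kGw2 := gGw2.mono_set hKK₂
  have kconst : ∀ c : ℝ, IntegrableOn (fun _ : ℝ × EuclideanSpace ℝ (Fin 3) => c) K volume := fun c =>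
    integrableOn_const (hs := hKc.measure_lt_top.ne)
  -- pointwise facts on `K`
  have hKmem : ∀ z ∈ K, z ∈ K₂ := fun z hz => hKK₂ hz
  have hσb : ∀ t, |σ t| ≤ 1 := fun t => by rw [abs_of_nonneg (hσ_nn t)]; exact hσ_le t
  -- the integrands
  set Fr : ℝ × EuclideanSpace ℝ (Fin 3) → ℝ := fun z => rise z.1 * (θ z.2 * ‖v z.1 z.2 - e z.1 z.2‖ ^ 2) with hFr
  set Ff : ℝ × EuclideanSpace ℝ (Fin 3) → ℝ := fun z => fall z.1 * (θ z.2 * ‖v z.1 z.2 - e z.1 z.2‖ ^ 2) with hFf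
  set Fd : ℝ × EuclideanSpace ℝ (Fin 3) → ℝ := fun z => deriv σ z.1 * (θ z.2 * ‖v z.1 z.2 - e z.1 z.2‖ ^ 2) with hFd
  set Fs : ℝ × EuclideanSpace ℝ (Fin 3) → ℝ := fun z => σ z.1 * (θ z.2 * ‖v z.1 z.2 - e z.1 z.2‖ ^ 2) with hFs
  set F1 : ℝ × EuclideanSpace ℝ (Fin 3) → ℝ := fun z => σ z.1 * (‖v z.1 z.2 - e z.1 z.2‖ ^ 2 * (Δ θ) z.2) with hF1
  set F2 : ℝ × EuclideanSpace ℝ (Fin 3) → ℝ := fun z => σ z.1 *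
    ((‖v z.1 z.2 - e z.1 z.2‖ ^ 2 - ‖e z.1 z.2‖ ^ 2) * ⟪v z.1 z.2, gradient θ z.2⟫) with hF2
  set F3 : ℝ × EuclideanSpace ℝ (Fin 3) → ℝ := fun z => σ z.1 *
    (π z.1 z.2 * ⟪v z.1 z.2 - e z.1 z.2, gradient θ z.2⟫) with hF3
  set F4 : ℝ × EuclideanSpace ℝ (Fin 3) → ℝ := fun z => σ z.1 * (θ z.2 *
    ⟪fderiv ℝ (e z.1) z.2 (v z.1 z.2 - e z.1 z.2), v z.1 z.2 - e z.1 z.2⟫) with hF4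
  set F5 : ℝ × EuclideanSpace ℝ (Fin 3) → ℝ := fun z => σ z.1 * (θ z.2 *
    ⟪fderiv ℝ (e z.1) z.2 (e z.1 z.2), v z.1 z.2 - e z.1 z.2⟫) with hF5
  set F6 : ℝ × EuclideanSpace ℝ (Fin 3) → ℝ := fun z => σ z.1 *
    (‖e z.1 z.2‖ ^ 2 * ⟪v z.1 z.2 - e z.1 z.2, gradient θ z.2⟫) with hF6
  set F7 : ℝ × EuclideanSpace ℝ (Fin 3) → ℝ := fun z => σ z.1 *
    (⟪e z.1 z.2, gradient θ z.2⟫ * ‖e z.1 z.2‖ ^ 2) with hF7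
  set FL : ℝ × EuclideanSpace ℝ (Fin 3) → ℝ := fun z => σ z.1 * (θ z.2 *
    frobeniusNormSq (G z.1 z.2 - fderiv ℝ (e z.1) z.2)) with hFL
  set FB : ℝ × EuclideanSpace ℝ (Fin 3) → ℝ := fun z => σ z.1 *
    (B.indicator (fun _ => (1 : ℝ)) z.2 * ‖v z.1 z.2 - e z.1 z.2‖ ^ 2) with hFB
  set FeB : ℝ × EuclideanSpace ℝ (Fin 3) → ℝ := fun z => σ z.1 *
    (B.indicator (fun _ => (1 : ℝ)) z.2 * (‖e z.1 z.2‖ * ‖v z.1 z.2 - e z.1 z.2‖ ^ 2)) with hFeB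
  -- vanishing off `K`
  have hB_off : ∀ z : ℝ × EuclideanSpace ℝ (Fin 3), z ∉ K → σ z.1 ≠ 0 → B.indicator (fun _ => (1 : ℝ)) z.2 = 0 := by
    intro z hz hσ0
    have h1 : z.1 ∈ Icc δ (τ - δ) := by
      by_contra h1
      exact hσ0 (hσz _ fun h' => h1 (Ioo_subset_Icc_self h'))
    have h2 : z.2 ∉ closedBall x₀ 3 := fun h2 => hz ⟨h1, h2⟩
    exact indicator_of_notMem (fun h' => h2 (ball_subset_closedBall h')) _
  have hKcases : ∀ z : ℝ × EuclideanSpace ℝ (Fin 3), z ∉ K →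
      z.1 ∉ Icc δ (τ - δ) ∨ z.2 ∉ closedBall x₀ 2 := by
    intro z hz
    by_cases h1 : z.1 ∈ Icc δ (τ - δ)
    · exact Or.inr fun h2 => hz ⟨h1, closedBall_subset_closedBall (by norm_num) h2⟩
    · exact Or.inl h1
  have hσK : ∀ t, t ∉ Icc δ (τ - δ) → σ t = 0 := fun t ht => hσz t fun h' => ht (Ioo_subset_Icc_self h')
  have hσ'K : ∀ t, t ∉ Icc δ (τ - δ) → deriv σ t = 0 := fun t ht => hσ'z t fun h' => ht (Ioo_subset_Icc_self h')
  have zFr : ∀ z, z ∉ K → Fr z = 0 := fun z hz => by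
    rcases hKcases z hz with h1 | h2
    · simp only [hFr, hriseK _ h1, zero_mul]
    · simp only [hFr, hθz _ h2, zero_mul, mul_zero]
  have zFf : ∀ z, z ∉ K → Ff z = 0 := fun z hz => by
    rcases hKcases z hz with h1 | h2
    · simp only [hFf, hfallK _ h1, zero_mul]
    · simp only [hFf, hθz _ h2, zero_mul, mul_zero]
  have zFd : ∀ z, z ∉ K → Fd z = 0 := fun z hz => by
    rcases hKcases z hz with h1 | h2
    · simp only [hFd, hσ'K _ h1, zero_mul]
    · simp only [hFd, hθz _ h2, zero_mul, mul_zero]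
  have zFs : ∀ z, z ∉ K → Fs z = 0 := fun z hz => by
    rcases hKcases z hz with h1 | h2
    · simp only [hFs, hσK _ h1, zero_mul]
    · simp only [hFs, hθz _ h2, zero_mul, mul_zero]
  have zF1 : ∀ z, z ∉ K → F1 z = 0 := fun z hz => by
    rcases hKcases z hz with h1 | h2
    · simp only [hF1, hσK _ h1, zero_mul]
    · simp only [hF1, hΔθz _ h2, mul_zero]
  have zF2 : ∀ z, z ∉ K → F2 z = 0 := fun z hz => by
    rcases hKcases z hz with h1 | h2
    · simp only [hF2, hσK _ h1, zero_mul]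
    · simp only [hF2, hgθz _ h2, inner_zero_right, mul_zero]
  have zF3 : ∀ z, z ∉ K → F3 z = 0 := fun z hz => by
    rcases hKcases z hz with h1 | h2
    · simp only [hF3, hσK _ h1, zero_mul]
    · simp only [hF3, hgθz _ h2, inner_zero_right, mul_zero]
  have zF4 : ∀ z, z ∉ K → F4 z = 0 := fun z hz => by
    rcases hKcases z hz with h1 | h2
    · simp only [hF4, hσK _ h1, zero_mul]
    · simp only [hF4, hθz _ h2, zero_mul, mul_zero]
  have zF5 : ∀ z, z ∉ K → F5 z = 0 := fun z hz => by
    rcases hKcases z hz with h1 | h2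
    · simp only [hF5, hσK _ h1, zero_mul]
    · simp only [hF5, hθz _ h2, zero_mul, mul_zero]
  have zF6 : ∀ z, z ∉ K → F6 z = 0 := fun z hz => by
    rcases hKcases z hz with h1 | h2
    · simp only [hF6, hσK _ h1, zero_mul]
    · simp only [hF6, hgθz _ h2, inner_zero_right, mul_zero]
  have zF7 : ∀ z, z ∉ K → F7 z = 0 := fun z hz => by
    rcases hKcases z hz with h1 | h2
    · simp only [hF7, hσK _ h1, zero_mul]
    · simp only [hF7, hgθz _ h2, inner_zero_right, zero_mul, mul_zero]
  have zFL : ∀ z, z ∉ K → FL z = 0 := fun z hz => by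
    rcases hKcases z hz with h1 | h2
    · simp only [hFL, hσK _ h1, zero_mul]
    · simp only [hFL, hθz _ h2, zero_mul, mul_zero]
  have hBz : ∀ x, x ∉ closedBall x₀ 3 → B.indicator (fun _ => (1 : ℝ)) x = 0 := fun x hx =>
    indicator_of_notMem (fun h' => hx (ball_subset_closedBall h')) _
  have hKcases' : ∀ z : ℝ × EuclideanSpace ℝ (Fin 3), z ∉ K →
      z.1 ∉ Icc δ (τ - δ) ∨ z.2 ∉ closedBall x₀ 3 := by
    intro z hz
    by_cases h1 : z.1 ∈ Icc δ (τ - δ)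
    · exact Or.inr fun h2 => hz ⟨h1, h2⟩
    · exact Or.inl h1
  have zFB : ∀ z, z ∉ K → FB z = 0 := fun z hz => by
    rcases hKcases' z hz with h1 | h2
    · simp only [hFB, hσK _ h1, zero_mul]
    · simp only [hFB, hBz _ h2, zero_mul, mul_zero]
  have zFeB : ∀ z, z ∉ K → FeB z = 0 := fun z hz => by
    rcases hKcases' z hz with h1 | h2
    · simp only [hFeB, hσK _ h1, zero_mul]
    · simp only [hFeB, hBz _ h2, zero_mul, mul_zero]
  -- integrability
  have hind_le : ∀ x, |B.indicator (fun _ => (1 : ℝ)) x| ≤ 1 := fun x => by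
    by_cases hx : x ∈ B
    · rw [indicator_of_mem hx, abs_one]
    · rw [indicator_of_notMem hx, abs_zero]; exact zero_le_one
  have iFr : Integrable Fr volume := by
    refine integrable_of_bound_on_compact hKc (kW2.const_mul Cr) (mrise.mul (mθ.mul (mw.norm.pow 2))) zFr
      fun z hz => ?_
    rw [hFr]; dsimp only
    rw [norm_mul, norm_mul, Real.norm_eq_abs (θ z.2), Real.norm_eq_abs (‖v z.1 z.2 - e z.1 z.2‖ ^ 2),
      abs_of_nonneg (sq_nonneg ‖v z.1 z.2 - e z.1 z.2‖)]
    calc ‖rise z.1‖ * (|θ z.2| * ‖v z.1 z.2 - e z.1 z.2‖ ^ 2) ≤ Cr * (1 * ‖v z.1 z.2 - e z.1 z.2‖ ^ 2) := by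
          gcongr
          · exact hCr z hz
          · exact hθabs z.2
      _ = Cr * ‖v z.1 z.2 - e z.1 z.2‖ ^ 2 := by ring
  have iFf : Integrable Ff volume := by
    refine integrable_of_bound_on_compact hKc (kW2.const_mul Cf) (mfall.mul (mθ.mul (mw.norm.pow 2))) zFf
      fun z hz => ?_
    rw [hFf]; dsimp only
    rw [norm_mul, norm_mul, Real.norm_eq_abs (θ z.2), Real.norm_eq_abs (‖v z.1 z.2 - e z.1 z.2‖ ^ 2),
      abs_of_nonneg (sq_nonneg ‖v z.1 z.2 - e z.1 z.2‖)]
    calc ‖fall z.1‖ * (|θ z.2| * ‖v z.1 z.2 - e z.1 z.2‖ ^ 2) ≤ Cf * (1 * ‖v z.1 z.2 - e z.1 z.2‖ ^ 2) := by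
          gcongr
          · exact hCf z hz
          · exact hθabs z.2
      _ = Cf * ‖v z.1 z.2 - e z.1 z.2‖ ^ 2 := by ring
  have iFs : Integrable Fs volume := by
    refine integrable_of_bound_on_compact hKc kW2 (mσ.mul (mθ.mul (mw.norm.pow 2))) zFs fun z hz => ?_
    rw [hFs]; dsimp only
    rw [norm_mul, norm_mul, Real.norm_eq_abs (θ z.2), Real.norm_eq_abs, Real.norm_eq_abs, abs_of_nonneg (sq_nonneg ‖v z.1 z.2 - e z.1 z.2‖)]
    calc |σ z.1| * (|θ z.2| * ‖v z.1 z.2 - e z.1 z.2‖ ^ 2) ≤ 1 * (1 * ‖v z.1 z.2 - e z.1 z.2‖ ^ 2) := by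
          gcongr
          · exact hσb z.1
          · exact hθabs z.2
      _ = ‖v z.1 z.2 - e z.1 z.2‖ ^ 2 := by ring
  have iFd : Integrable Fd volume := by
    have e1 : Fd = fun z => Fr z - Ff z := by
      funext z; simp only [hFd, hFr, hFf, hσ' z.1]; ring
    rw [e1]; exact iFr.sub iFf
  have iF1 : Integrable F1 volume := by
    refine integrable_of_bound_on_compact hKc (kW2.const_mul cΔ) (mσ.mul ((mw.norm.pow 2).mul mΔθ)) zF1
      fun z hz => ?_
    rw [hF1]; dsimp only
    rw [norm_mul, norm_mul, Real.norm_eq_abs, Real.norm_eq_abs, Real.norm_eq_abs, abs_of_nonneg (sq_nonneg ‖v z.1 z.2 - e z.1 z.2‖)]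
    calc |σ z.1| * (‖v z.1 z.2 - e z.1 z.2‖ ^ 2 * |(Δ θ) z.2|) ≤ 1 * (‖v z.1 z.2 - e z.1 z.2‖ ^ 2 * cΔ) := by
          gcongr
          · exact hσb z.1
          · exact hΔθ z.2
      _ = cΔ * ‖v z.1 z.2 - e z.1 z.2‖ ^ 2 := by ring
  have iF2 : Integrable F2 volume := by
    refine integrable_of_bound_on_compact hKc ((kW2U.add (kU1.const_mul (Ce ^ 2))).const_mul (2 * c₁))
      (mσ.mul (((mw.norm.pow 2).sub (me.norm.pow 2)).mul (mv.inner mgθ))) zF2 fun z hz => ?_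
    rw [hF2]; dsimp only
    rw [norm_mul, norm_mul, Real.norm_eq_abs, Real.norm_eq_abs, Real.norm_eq_abs]
    have h1 : |‖v z.1 z.2 - e z.1 z.2‖ ^ 2 - ‖e z.1 z.2‖ ^ 2| ≤ ‖v z.1 z.2 - e z.1 z.2‖ ^ 2 + Ce ^ 2 := by
      refine (abs_sub _ _).trans ?_
      rw [abs_of_nonneg (sq_nonneg ‖v z.1 z.2 - e z.1 z.2‖), abs_of_nonneg (sq_nonneg ‖e z.1 z.2‖)]
      exact add_le_add le_rfl (pow_le_pow_left₀ (norm_nonneg _) (heb z (hKmem z hz)) 2)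
    have h2 := hgradθ z.2 (v z.1 z.2)
    simp only [Pi.add_apply]
    calc |σ z.1| * (|‖v z.1 z.2 - e z.1 z.2‖ ^ 2 - ‖e z.1 z.2‖ ^ 2| * |⟪v z.1 z.2, gradient θ z.2⟫|)
        ≤ 1 * ((‖v z.1 z.2 - e z.1 z.2‖ ^ 2 + Ce ^ 2) * (2 * c₁ * ‖v z.1 z.2‖)) := by
          gcongr
          exact hσb z.1
      _ = 2 * c₁ * (‖v z.1 z.2 - e z.1 z.2‖ ^ 2 * ‖v z.1 z.2‖ + Ce ^ 2 * ‖v z.1 z.2‖) := by ring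
  have iF3 : Integrable F3 volume := by
    refine integrable_of_bound_on_compact hKc (kPW.const_mul (2 * c₁)) (mσ.mul (mπ.mul (mw.inner mgθ))) zF3
      fun z hz => ?_
    rw [hF3]; dsimp only
    rw [norm_mul, norm_mul, Real.norm_eq_abs, Real.norm_eq_abs, Real.norm_eq_abs]
    have h2 := hgradθ z.2 (v z.1 z.2 - e z.1 z.2)
    calc |σ z.1| * (|π z.1 z.2| * |⟪v z.1 z.2 - e z.1 z.2, gradient θ z.2⟫|)
        ≤ 1 * (|π z.1 z.2| * (2 * c₁ * ‖v z.1 z.2 - e z.1 z.2‖)) := by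
          gcongr
          exact hσb z.1
      _ = 2 * c₁ * (|π z.1 z.2| * ‖v z.1 z.2 - e z.1 z.2‖) := by ring
  have iF4 : Integrable F4 volume := by
    refine integrable_of_bound_on_compact hKc (kW2.const_mul CDe) (mσ.mul (mθ.mul (mDew.inner mw))) zF4
      fun z hz => ?_
    rw [hF4]; dsimp only
    rw [norm_mul, norm_mul, Real.norm_eq_abs, Real.norm_eq_abs]
    have h1 : ‖⟪fderiv ℝ (e z.1) z.2 (v z.1 z.2 - e z.1 z.2), v z.1 z.2 - e z.1 z.2⟫‖ ≤
        CDe * ‖v z.1 z.2 - e z.1 z.2‖ ^ 2 := by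
      refine (norm_inner_le_norm _ _).trans ?_
      calc ‖fderiv ℝ (e z.1) z.2 (v z.1 z.2 - e z.1 z.2)‖ * ‖v z.1 z.2 - e z.1 z.2‖
          ≤ (CDe * ‖v z.1 z.2 - e z.1 z.2‖) * ‖v z.1 z.2 - e z.1 z.2‖ :=
            mul_le_mul_of_nonneg_right ((ContinuousLinearMap.le_opNorm _ _).trans
              (mul_le_mul_of_nonneg_right (hDeb z (hKmem z hz)) (norm_nonneg _))) (norm_nonneg _)
        _ = CDe * ‖v z.1 z.2 - e z.1 z.2‖ ^ 2 := by ring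
    calc |σ z.1| * (|θ z.2| * ‖⟪fderiv ℝ (e z.1) z.2 (v z.1 z.2 - e z.1 z.2), v z.1 z.2 - e z.1 z.2⟫‖)
        ≤ 1 * (1 * (CDe * ‖v z.1 z.2 - e z.1 z.2‖ ^ 2)) := by
          gcongr
          · exact hσb z.1
          · exact hθabs z.2
      _ = CDe * ‖v z.1 z.2 - e z.1 z.2‖ ^ 2 := by ring
  have iF5 : Integrable F5 volume := by
    refine integrable_of_bound_on_compact hKc (kW1.const_mul (CDe * Ce)) (mσ.mul (mθ.mul (mDee.inner mw))) zF5
      fun z hz => ?_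
    rw [hF5]; dsimp only
    rw [norm_mul, norm_mul, Real.norm_eq_abs, Real.norm_eq_abs]
    have h1 : ‖⟪fderiv ℝ (e z.1) z.2 (e z.1 z.2), v z.1 z.2 - e z.1 z.2⟫‖ ≤ CDe * Ce * ‖v z.1 z.2 - e z.1 z.2‖ := by
      refine (norm_inner_le_norm _ _).trans (mul_le_mul_of_nonneg_right ?_ (norm_nonneg _))
      exact (ContinuousLinearMap.le_opNorm _ _).trans (mul_le_mul (hDeb z (hKmem z hz)) (heb z (hKmem z hz))
        (norm_nonneg _) hCDe0)
    calc |σ z.1| * (|θ z.2| * ‖⟪fderiv ℝ (e z.1) z.2 (e z.1 z.2), v z.1 z.2 - e z.1 z.2⟫‖)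
        ≤ 1 * (1 * (CDe * Ce * ‖v z.1 z.2 - e z.1 z.2‖)) := by
          gcongr
          · exact hσb z.1
          · exact hθabs z.2
      _ = CDe * Ce * ‖v z.1 z.2 - e z.1 z.2‖ := by ring
  have iF6 : Integrable F6 volume := by
    refine integrable_of_bound_on_compact hKc (kW1.const_mul (Ce ^ 2 * (2 * c₁)))
      (mσ.mul ((me.norm.pow 2).mul (mw.inner mgθ))) zF6 fun z hz => ?_
    rw [hF6]; dsimp only
    rw [norm_mul, norm_mul, Real.norm_eq_abs, Real.norm_eq_abs, Real.norm_eq_abs, abs_of_nonneg (sq_nonneg ‖e z.1 z.2‖)]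
    have h2 := hgradθ z.2 (v z.1 z.2 - e z.1 z.2)
    calc |σ z.1| * (‖e z.1 z.2‖ ^ 2 * |⟪v z.1 z.2 - e z.1 z.2, gradient θ z.2⟫|)
        ≤ 1 * (Ce ^ 2 * (2 * c₁ * ‖v z.1 z.2 - e z.1 z.2‖)) := by
          gcongr
          · exact hσb z.1
          · exact heb z (hKmem z hz)
      _ = Ce ^ 2 * (2 * c₁) * ‖v z.1 z.2 - e z.1 z.2‖ := by ring
  have iF7 : Integrable F7 volume := by
    refine integrable_of_bound_on_compact hKc (kconst (2 * c₁ * Ce * Ce ^ 2))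
      (mσ.mul ((me.inner mgθ).mul (me.norm.pow 2))) zF7 fun z hz => ?_
    rw [hF7]; dsimp only
    rw [norm_mul, norm_mul, Real.norm_eq_abs, Real.norm_eq_abs, Real.norm_eq_abs, abs_of_nonneg (sq_nonneg ‖e z.1 z.2‖)]
    have h2 := hgradθ z.2 (e z.1 z.2)
    calc |σ z.1| * (|⟪e z.1 z.2, gradient θ z.2⟫| * ‖e z.1 z.2‖ ^ 2)
        ≤ 1 * ((2 * c₁ * Ce) * Ce ^ 2) := by
          gcongr
          · exact hσb z.1
          · exact h2.trans (by have := heb z (hKmem z hz); gcongr)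
          · exact heb z (hKmem z hz)
      _ = 2 * c₁ * Ce * Ce ^ 2 := by ring
  have iFL : Integrable FL volume := by
    refine integrable_of_bound_on_compact hKc kGw2
      (mσ.mul (mθ.mul (hfrob_c.comp_aestronglyMeasurable (mG.sub mDe)))) zFL fun z hz => ?_
    rw [hFL]; dsimp only
    rw [norm_mul, norm_mul, Real.norm_eq_abs, Real.norm_eq_abs, Real.norm_eq_abs,
      abs_of_nonneg (frobeniusNormSq_nonneg _)]
    calc |σ z.1| * (|θ z.2| * frobeniusNormSq (G z.1 z.2 - fderiv ℝ (e z.1) z.2))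
        ≤ 1 * (1 * frobeniusNormSq (G z.1 z.2 - fderiv ℝ (e z.1) z.2)) :=
          mul_le_mul (hσb z.1) (mul_le_mul_of_nonneg_right (hθabs z.2) (frobeniusNormSq_nonneg _))
            (mul_nonneg (abs_nonneg _) (frobeniusNormSq_nonneg _)) zero_le_one
      _ = frobeniusNormSq (G z.1 z.2 - fderiv ℝ (e z.1) z.2) := by ring
  have iFB : Integrable FB volume := by
    refine integrable_of_bound_on_compact hKc kW2 (mσ.mul (mB.mul (mw.norm.pow 2))) zFB fun z hz => ?_
    rw [hFB]; dsimp only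
    rw [norm_mul, norm_mul, Real.norm_eq_abs, Real.norm_eq_abs, Real.norm_eq_abs, abs_of_nonneg (sq_nonneg ‖v z.1 z.2 - e z.1 z.2‖)]
    calc |σ z.1| * (|B.indicator (fun _ => (1 : ℝ)) z.2| * ‖v z.1 z.2 - e z.1 z.2‖ ^ 2)
        ≤ 1 * (1 * ‖v z.1 z.2 - e z.1 z.2‖ ^ 2) := by
          gcongr
          · exact hσb z.1
          · exact hind_le z.2
      _ = ‖v z.1 z.2 - e z.1 z.2‖ ^ 2 := by ring
  have iFeB : Integrable FeB volume := by
    refine integrable_of_bound_on_compact hKc (kW2.const_mul Ce)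
      (mσ.mul (mB.mul (me.norm.mul (mw.norm.pow 2)))) zFeB fun z hz => ?_
    rw [hFeB]; dsimp only
    rw [norm_mul, norm_mul, norm_mul, Real.norm_eq_abs, Real.norm_eq_abs, norm_norm, Real.norm_eq_abs,
      abs_of_nonneg (sq_nonneg ‖v z.1 z.2 - e z.1 z.2‖)]
    calc |σ z.1| * (|B.indicator (fun _ => (1 : ℝ)) z.2| * (‖e z.1 z.2‖ * ‖v z.1 z.2 - e z.1 z.2‖ ^ 2))
        ≤ 1 * (1 * (Ce * ‖v z.1 z.2 - e z.1 z.2‖ ^ 2)) := by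
          gcongr
          · exact hσb z.1
          · exact hind_le z.2
          · exact heb z (hKmem z hz)
      _ = Ce * ‖v z.1 z.2 - e z.1 z.2‖ ^ 2 := by ring
  -- ### §7 the windowed inequality in product-integral form
  have hσ_app : ∀ t, timePlateau δ τ t = σ t := fun t => rfl
  simp only [hσ_app] at h5
  have c1 : (∫ t, ∫ x, (deriv σ t * (θ x * ‖v t x - e t x‖ ^ 2) + σ t * (‖v t x - e t x‖ ^ 2 * (Δ θ) x))) =
      (∫ z, Fd z) + ∫ z, F1 z := by
    rw [← integral_add iFd iF1]; exact (integral_prod (μ := volume) (ν := volume) _ (iFd.add iF1)).symm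
  have cL : (∫ t, ∫ x, σ t * (θ x * frobeniusNormSq (G t x - fderiv ℝ (e t) x))) = ∫ z, FL z :=
    (integral_prod (μ := volume) (ν := volume) _ iFL).symm
  have c2 : (∫ t, ∫ x, σ t * ((‖v t x - e t x‖ ^ 2 - ‖e t x‖ ^ 2) * ⟪v t x, gradient θ x⟫)) = ∫ z, F2 z :=
    (integral_prod (μ := volume) (ν := volume) _ iF2).symm
  have c3 : (∫ t, ∫ x, σ t * (π t x * ⟪v t x - e t x, gradient θ x⟫)) = ∫ z, F3 z :=
    (integral_prod (μ := volume) (ν := volume) _ iF3).symm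
  have c4 : (∫ t, ∫ x, σ t * (θ x * ⟪fderiv ℝ (e t) x (v t x - e t x), v t x - e t x⟫)) = ∫ z, F4 z :=
    (integral_prod (μ := volume) (ν := volume) _ iF4).symm
  have c5 : (∫ t, ∫ x, σ t * (θ x * ⟪fderiv ℝ (e t) x (e t x), v t x - e t x⟫)) = ∫ z, F5 z :=
    (integral_prod (μ := volume) (ν := volume) _ iF5).symm
  have c6 : (∫ t, ∫ x, σ t * (‖e t x‖ ^ 2 * ⟪v t x - e t x, gradient θ x⟫)) = ∫ z, F6 z :=
    (integral_prod (μ := volume) (ν := volume) _ iF6).symm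
  have c7 : (∫ t, ∫ x, σ t * (⟪e t x, gradient θ x⟫ * ‖e t x‖ ^ 2)) = ∫ z, F7 z :=
    (integral_prod (μ := volume) (ν := volume) _ iF7).symm
  rw [c1, cL, c2, c3, c4, c5, c6, c7] at h5
  -- ### §8 slices: `∫ Fd = ∫ ρ⁺Y - ∫ ρ⁻Y`, `∫ Fs = ∫ σY`
  have iRY : Integrable (fun t => rise t * Y t) volume := by
    refine (iFr.integral_prod_left (μ := volume) (ν := volume)).congr (ae_of_all _ fun t => ?_)
    show (∫ x, Fr (t, x)) = rise t * Y t
    exact integral_const_mul (rise t) fun x => θ x * ‖v t x - e t x‖ ^ 2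
  have iFY : Integrable (fun t => fall t * Y t) volume := by
    refine (iFf.integral_prod_left (μ := volume) (ν := volume)).congr (ae_of_all _ fun t => ?_)
    show (∫ x, Ff (t, x)) = fall t * Y t
    exact integral_const_mul (fall t) fun x => θ x * ‖v t x - e t x‖ ^ 2
  have iSY : Integrable (fun t => σ t * Y t) volume := by
    refine (iFs.integral_prod_left (μ := volume) (ν := volume)).congr (ae_of_all _ fun t => ?_)
    show (∫ x, Fs (t, x)) = σ t * Y t
    exact integral_const_mul (σ t) fun x => θ x * ‖v t x - e t x‖ ^ 2
  have dFd : (∫ z, Fd z) = ∫ t, ∫ x, Fd (t, x) := integral_prod (μ := volume) (ν := volume) _ iFd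
  have dFs : (∫ z, Fs z) = ∫ t, ∫ x, Fs (t, x) := integral_prod (μ := volume) (ν := volume) _ iFs
  have vFd : (∫ z, Fd z) = (∫ t, rise t * Y t) - ∫ t, fall t * Y t := by
    rw [dFd, ← integral_sub iRY iFY]
    refine integral_congr_ae (ae_of_all _ fun t => ?_)
    show (∫ x, Fd (t, x)) = rise t * Y t - fall t * Y t
    have : (∫ x, Fd (t, x)) = deriv σ t * Y t :=
      integral_const_mul (deriv σ t) fun x => θ x * ‖v t x - e t x‖ ^ 2
    rw [this, hσ' t]; ring
  have vFs : (∫ z, Fs z) = ∫ t, σ t * Y t := by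
    rw [dFs]
    refine integral_congr_ae (ae_of_all _ fun t => ?_)
    show (∫ x, Fs (t, x)) = σ t * Y t
    exact integral_const_mul (σ t) fun x => θ x * ‖v t x - e t x‖ ^ 2
  -- the Grönwall term is finite
  have hY0 : ∀ t, 0 ≤ Y t := fun t => integral_nonneg fun x => mul_nonneg (hθ0 x) (sq_nonneg _)
  have hSY0 : 0 ≤ ∫ t, σ t * Y t := integral_nonneg fun t => mul_nonneg (hσ_nn t) (hY0 t)
  have hΛfin : (∫⁻ t, ENNReal.ofReal (σ t * (P t * Y t))) ≤
      ENNReal.ofReal Pstar * ENNReal.ofReal (∫ t, σ t * Y t) := by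
    rw [ofReal_integral_eq_lintegral_ofReal iSY (ae_of_all _ fun t => mul_nonneg (hσ_nn t) (hY0 t)),
      ← lintegral_const_mul' _ _ ENNReal.ofReal_ne_top]
    refine lintegral_mono fun t => ?_
    rw [← ENNReal.ofReal_mul hPstar0]
    refine ENNReal.ofReal_le_ofReal ?_
    by_cases ht : σ t = 0
    · rw [ht]; simp
    · have ht' : t ∈ Ioo δ (τ - δ) := by by_contra h'; exact ht (hσz t h')
      have hP := hPstar t (by linarith [ht'.1])
      have := mul_le_mul_of_nonneg_left (mul_le_mul_of_nonneg_right hP (hY0 t)) (hσ_nn t)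
      linarith
  have hΛfin' : (∫⁻ t, ENNReal.ofReal (σ t * (P t * Y t))) ≠ ∞ :=
    (lt_of_le_of_lt hΛfin (ENNReal.mul_lt_top ENNReal.ofReal_lt_top ENNReal.ofReal_lt_top)).ne
  -- ### §9 the critical coupling at almost every slice
  have hmeas₀ : AEStronglyMeasurable (uncurry v)
      ((volume : Measure (ℝ × EuclideanSpace ℝ (Fin 3))).restrict (Ioo 0 T ×ˢ univ)) := h.aestronglyMeasurable
  have hgood1 := ae_slice_aestronglyMeasurable_and_lintegral_ball_lt_top hmeas₀ (fun K' hK' => h.sqIntegrable K' hK')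
  have hgood2 := hG.ae_hasWeakFDerivOn_slice_slab
  have hgood3 := h.ae_trace_slice_eq_zero hG
  have hgood4 := h.ae_lintegral_grad_sq_ball_lt_top hG
  have hgood : ∀ᵐ t ∂(volume : Measure ℝ), t ∈ Ioo 0 T →
      (AEStronglyMeasurable (v t) volume ∧
        ∀ n : ℕ, ∫⁻ x in closedBall (0 : EuclideanSpace ℝ (Fin 3)) n, ‖v t x‖ₑ ^ 2 < ∞) ∧
      HasWeakFDerivOn (⊤ : Opens (EuclideanSpace ℝ (Fin 3))) volume (v t) (G t) ∧
      (∀ᵐ x ∂(volume : Measure (EuclideanSpace ℝ (Fin 3))), ∑ j, G t x (EuclideanSpace.single j (1 : ℝ)) j = 0) ∧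
      ∀ n : ℕ, ∫⁻ x in ball (0 : EuclideanSpace ℝ (Fin 3)) n, ‖G t x‖ₑ ^ 2 < ∞ := by
    have h1 := (ae_restrict_iff' (measurableSet_Ioo (a := (0:ℝ)) (b := T))).1 hgood1
    have h2 := (ae_restrict_iff' (measurableSet_Ioo (a := (0:ℝ)) (b := T))).1 hgood2
    have h3 := (ae_restrict_iff' (measurableSet_Ioo (a := (0:ℝ)) (b := T))).1 hgood3
    have h4 := (ae_restrict_iff' (measurableSet_Ioo (a := (0:ℝ)) (b := T))).1 hgood4
    filter_upwards [h1, h2, h3, h4] with t h1 h2 h3 h4 ht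
    exact ⟨h1 ht, h2 ht, h3 ht, h4 ht⟩
  have hslFeB : ∀ᵐ t ∂(volume : Measure ℝ), Integrable (fun x => FeB (t, x)) volume :=
    iFeB.prod_right_ae (μ := volume) (ν := volume)
  -- a ball around the origin containing `B`
  set n : ℕ := ⌈‖x₀‖ + 3⌉₊ with hn
  have hBn : B ⊆ ball (0 : EuclideanSpace ℝ (Fin 3)) n := by
    intro x hx
    rw [mem_ball, dist_eq_norm, sub_zero]
    rw [mem_ball, dist_eq_norm] at hx
    have h1 : ‖x‖ ≤ ‖x - x₀‖ + ‖x₀‖ := norm_le_norm_sub_add x x₀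
    have h2 : ‖x₀‖ + 3 ≤ n := Nat.le_ceil _
    linarith
  have hθtest : IsTestFunctionOn (⟨ball x₀ 3, isOpen_ball⟩ : Opens (EuclideanSpace ℝ (Fin 3))) θ := ⟨hθs, hθc, hθB⟩
  have hDθz : ∀ x, x ∉ closedBall x₀ 2 → fderiv ℝ θ x = 0 := fun x hx =>
    image_eq_zero_of_notMem_tsupport fun h' => hx (hθts (tsupport_fderiv_subset ℝ h'))
  have hF4_ae : ∀ᵐ t ∂(volume : Measure ℝ),
      -2 * (∫ x, F4 (t, x)) ≤ (∫ x, FL (t, x)) + (∫ x, Fs (t, x)) + c₁ ^ 2 * (∫ x, FB (t, x)) +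
        4 * c₁ * (∫ x, FeB (t, x)) + K₀ * (σ t * (P t * Y t)) := by
    filter_upwards [hgood, hslFeB] with t hg hFeBt
    by_cases hσt : σ t = 0
    · have e0 : ∀ (F : EuclideanSpace ℝ (Fin 3) → ℝ), (∫ x, σ t * F x) = 0 := fun F => by
        rw [integral_const_mul, hσt, zero_mul]
      show -2 * (∫ x, σ t * _) ≤ (∫ x, σ t * _) + (∫ x, σ t * _) + c₁ ^ 2 * (∫ x, σ t * _) +
        4 * c₁ * (∫ x, σ t * _) + K₀ * (σ t * (P t * Y t))
      rw [e0, e0, e0, e0, e0, hσt]; simp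
    -- a good slice inside the window
    have htI : t ∈ Ioo δ (τ - δ) := by by_contra h'; exact hσt (hσz t h')
    have ht0 : 0 < t := by linarith [htI.1]
    have htT : t ∈ Ioo 0 T := ⟨ht0, by linarith [htI.2]⟩
    have htδ : δ / 2 ≤ t := by linarith [htI.1]
    obtain ⟨⟨hvmeas, hvball⟩, hvW, htr0, hGball⟩ := hg htT
    have hxK₂ : ∀ x ∈ closedBall x₀ 3, ((t, x) : ℝ × EuclideanSpace ℝ (Fin 3)) ∈ K₂ := fun x hx =>
      ⟨⟨htδ, by linarith [htI.2]⟩, hx⟩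
    set wt : EuclideanSpace ℝ (Fin 3) → EuclideanSpace ℝ (Fin 3) := fun x => v t x - e t x with hwt
    set gt : EuclideanSpace ℝ (Fin 3) → EuclideanSpace ℝ (Fin 3) →L[ℝ] EuclideanSpace ℝ (Fin 3) :=
      fun x => G t x - fderiv ℝ (e t) x with hgt
    have het : ContDiff ℝ (⊤ : ℕ∞) (e t) := he1 t htδ
    have het1 : ContDiff ℝ 1 (e t) := contDiff_infty.1 het 1
    have hecont : Continuous (e t) := het.continuous
    -- (1) the weak derivative of the slice of `w`
    have hwtop : HasWeakFDerivOn (⊤ : Opens (EuclideanSpace ℝ (Fin 3))) volume wt gt :=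
      hvW.sub (HasWeakFDerivOn.of_contDiff_holds ⊤ volume het1)
    have hwB : HasWeakFDerivOn (⟨ball x₀ 3, isOpen_ball⟩ : Opens (EuclideanSpace ℝ (Fin 3))) volume wt gt :=
      HasWeakFDerivOn.mono_set_holds hwtop le_top
    -- (2) `L²` bounds on `B`
    have hv2B : ∫⁻ x in B, ‖v t x‖ₑ ^ 2 < ∞ :=
      (lintegral_mono_set (hBn.trans ball_subset_closedBall)).trans_lt (hvball n)
    have he2B : ∫⁻ x in B, ‖e t x‖ₑ ^ 2 ≤ ENNReal.ofReal (Ce ^ 2) * volume B := by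
      rw [← setLIntegral_const]
      refine setLIntegral_mono' hBm fun x hx => ?_
      rw [← ofReal_norm, ← ENNReal.ofReal_pow (norm_nonneg _)]
      exact ENNReal.ofReal_le_ofReal (pow_le_pow_left₀ (norm_nonneg _) (heb _ (hxK₂ x (ball_subset_closedBall hx))) 2)
    have hvolB : volume B < ∞ := measure_ball_lt_top
    have hvm2 : AEMeasurable (fun x => ‖v t x‖ₑ ^ 2) (volume.restrict B) :=
      (hvmeas.aemeasurable.enorm.pow_const _).restrict
    have hw2 : ∫⁻ x in B, ‖wt x‖ₑ ^ 2 < ∞ := by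
      have hA : ∫⁻ x in B, 2 * ‖v t x‖ₑ ^ 2 < ∞ := by
        rw [lintegral_const_mul'' _ hvm2]; exact ENNReal.mul_lt_top ENNReal.ofNat_lt_top hv2B
      have hB' : ∫⁻ x in B, 2 * ‖e t x‖ₑ ^ 2 < ∞ := by
        rw [lintegral_const_mul' _ _ ENNReal.ofNat_ne_top]
        exact ENNReal.mul_lt_top ENNReal.ofNat_lt_top
          (lt_of_le_of_lt he2B (ENNReal.mul_lt_top ENNReal.ofReal_lt_top hvolB))
      calc ∫⁻ x in B, ‖wt x‖ₑ ^ 2 ≤ ∫⁻ x in B, (2 * ‖v t x‖ₑ ^ 2 + 2 * ‖e t x‖ₑ ^ 2) :=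
            lintegral_mono fun x => enorm_sub_sq_le_two _ _
        _ = (∫⁻ x in B, 2 * ‖v t x‖ₑ ^ 2) + ∫⁻ x in B, 2 * ‖e t x‖ₑ ^ 2 :=
            lintegral_add_left' (hvm2.const_mul _) _
        _ < ∞ := ENNReal.add_lt_top.2 ⟨hA, hB'⟩
    -- (3) the gradient of the slice on `B`
    have hG2B : ∫⁻ x in B, ‖G t x‖ₑ ^ 2 < ∞ := (lintegral_mono_set hBn).trans_lt (hGball n)
    have hg2frob : ∫⁻ x in B, ENNReal.ofReal (frobeniusNormSq (gt x)) < ∞ := by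
      have hpt : ∀ x ∈ B, ENNReal.ofReal (frobeniusNormSq (gt x)) ≤
          6 * ‖G t x‖ₑ ^ 2 + ENNReal.ofReal (6 * CDe ^ 2) := by
        intro x hx
        have h1 : frobeniusNormSq (gt x) ≤ 2 * frobeniusNormSq (G t x) + 2 * frobeniusNormSq (-fderiv ℝ (e t) x) := by
          have := frobeniusNormSq_add_le_two_mul (G t x) (-fderiv ℝ (e t) x)
          rwa [← sub_eq_add_neg] at this
        have h2 : frobeniusNormSq (G t x) ≤ 3 * ‖G t x‖ ^ 2 := frobeniusNormSq_le_three_mul _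
        have h3 : frobeniusNormSq (-fderiv ℝ (e t) x) ≤ 3 * CDe ^ 2 := by
          have := frobeniusNormSq_le_three_mul (-fderiv ℝ (e t) x)
          rw [norm_neg] at this
          exact this.trans (by have := hDeb _ (hxK₂ x (ball_subset_closedBall hx)); gcongr)
        calc ENNReal.ofReal (frobeniusNormSq (gt x)) ≤ ENNReal.ofReal (6 * ‖G t x‖ ^ 2 + 6 * CDe ^ 2) :=
              ENNReal.ofReal_le_ofReal (by linarith)
          _ = 6 * ‖G t x‖ₑ ^ 2 + ENNReal.ofReal (6 * CDe ^ 2) := by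
              rw [ENNReal.ofReal_add (by positivity) (by positivity), ENNReal.ofReal_mul (by norm_num),
                ENNReal.ofReal_pow (norm_nonneg _), ofReal_norm, ENNReal.ofReal_ofNat]
      have hGm' : AEMeasurable (fun x => ‖G t x‖ₑ ^ 2) (volume.restrict B) :=
        (hvW.locallyIntegrableOn_deriv.aestronglyMeasurable.aemeasurable.enorm.pow_const _).mono_measure
          (Measure.restrict_mono (subset_univ _) le_rfl)
      have hA : ∫⁻ x in B, 6 * ‖G t x‖ₑ ^ 2 < ∞ := by
        rw [lintegral_const_mul'' _ hGm']; exact ENNReal.mul_lt_top ENNReal.ofNat_lt_top hG2B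
      have hB' : ∫⁻ x in B, ENNReal.ofReal (6 * CDe ^ 2) < ∞ := by
        rw [setLIntegral_const]; exact ENNReal.mul_lt_top ENNReal.ofReal_lt_top hvolB
      calc ∫⁻ x in B, ENNReal.ofReal (frobeniusNormSq (gt x))
          ≤ ∫⁻ x in B, (6 * ‖G t x‖ₑ ^ 2 + ENNReal.ofReal (6 * CDe ^ 2)) := setLIntegral_mono' hBm hpt
        _ = (∫⁻ x in B, 6 * ‖G t x‖ₑ ^ 2) + ∫⁻ x in B, ENNReal.ofReal (6 * CDe ^ 2) :=
            lintegral_add_left' (hGm'.const_mul _) _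
        _ < ∞ := ENNReal.add_lt_top.2 ⟨hA, hB'⟩
    have hg2 : ∫⁻ x in B, ‖gt x‖ₑ ^ 2 < ∞ := by
      refine lt_of_le_of_lt (lintegral_mono fun x => ?_) hg2frob
      rw [← ofReal_norm, ← ENNReal.ofReal_pow (norm_nonneg _)]
      exact ENNReal.ofReal_le_ofReal (sq_opNorm_le_sum_sq_norm_apply (stdOrthonormalBasis ℝ (EuclideanSpace ℝ (Fin 3))) _)
    -- (4) the trace of the slice gradient vanishes
    have htr : ∀ᵐ x ∂(volume.restrict B), ∑ j, gt x (EuclideanSpace.single j (1 : ℝ)) j = 0 := by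
      refine ae_restrict_of_ae (htr0.mono fun x hx => ?_)
      have hde := sum_fderiv_single_eq_zero_of_isDivFree (hediv t htδ) x
      simp only [hgt, _root_.sub_apply, PiLp.sub_apply, Finset.sum_sub_distrib, hx, hde, sub_zero]
    -- (5) integration by parts of the critical coupling
    have hIBP := setIntegral_mul_inner_fderiv_apply_self_eq hwB hw2 hg2 htr het hθtest
    have hB2 : ∀ x, x ∉ B → x ∉ closedBall x₀ 2 := fun x hx h' => hx (closedBall_subset_ball (by norm_num) h')
    have eI4 : (∫ x in B, θ x * ⟪fderiv ℝ (e t) x (wt x), wt x⟫) = ∫ x, θ x * ⟪fderiv ℝ (e t) x (wt x), wt x⟫ :=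
      setIntegral_eq_integral_of_forall_compl_eq_zero fun x hx => by rw [hθz x (hB2 x hx), zero_mul]
    have eJ1 : (∫ x in B, fderiv ℝ θ x (wt x) * ⟪e t x, wt x⟫) = ∫ x, fderiv ℝ θ x (wt x) * ⟪e t x, wt x⟫ :=
      setIntegral_eq_integral_of_forall_compl_eq_zero fun x hx => by
        rw [hDθz x (hB2 x hx), _root_.zero_apply, zero_mul]
    have eJ2 : (∫ x in B, θ x * ⟪gt x (wt x), e t x⟫) = ∫ x, θ x * ⟪gt x (wt x), e t x⟫ :=
      setIntegral_eq_integral_of_forall_compl_eq_zero fun x hx => by rw [hθz x (hB2 x hx), zero_mul]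
    rw [eI4, eJ1, eJ2] at hIBP
    -- (6) the trilinear bound
    have h2J2 := htri x₀ wt gt χ c₁ (e t) hwB hw2 hg2frob hχs hχB hχ1 hc₁ hDχ hecont (he5 t ht0)
    -- (7) the transport term of the integration by parts
    have iEB : Integrable (fun x => B.indicator (fun _ => (1 : ℝ)) x * (‖e t x‖ * ‖wt x‖ ^ 2)) volume := by
      have h1 : Integrable (fun x => σ t * (B.indicator (fun _ => (1 : ℝ)) x * (‖e t x‖ * ‖wt x‖ ^ 2))) volume := hFeBt
      have h2 := h1.const_mul (σ t)⁻¹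
      refine h2.congr (ae_of_all _ fun x => ?_)
      show (σ t)⁻¹ * (σ t * _) = _
      rw [← mul_assoc, inv_mul_cancel₀ hσt, one_mul]
    have hJ1 : |∫ x, fderiv ℝ θ x (wt x) * ⟪e t x, wt x⟫| ≤
        2 * c₁ * ∫ x, B.indicator (fun _ => (1 : ℝ)) x * (‖e t x‖ * ‖wt x‖ ^ 2) := by
      rw [← integral_const_mul]
      refine abs_integral_le_integral_abs.trans (integral_mono_of_nonneg (ae_of_all _ fun x => abs_nonneg _)
        (iEB.const_mul _) (ae_of_all _ fun x => ?_))
      dsimp only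
      by_cases hx : x ∈ B
      · rw [indicator_of_mem hx, one_mul, abs_mul]
        have h1 : |fderiv ℝ θ x (wt x)| ≤ 2 * c₁ * ‖wt x‖ := by
          rw [← Real.norm_eq_abs]
          exact (ContinuousLinearMap.le_opNorm _ _).trans (mul_le_mul_of_nonneg_right (hDθ x) (norm_nonneg _))
        have h2 : |⟪e t x, wt x⟫| ≤ ‖e t x‖ * ‖wt x‖ := abs_real_inner_le_norm _ _
        calc |fderiv ℝ θ x (wt x)| * |⟪e t x, wt x⟫| ≤ (2 * c₁ * ‖wt x‖) * (‖e t x‖ * ‖wt x‖) :=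
              mul_le_mul h1 h2 (abs_nonneg _) (by positivity)
          _ = 2 * c₁ * (‖e t x‖ * ‖wt x‖ ^ 2) := by ring
      · rw [hDθz x (hB2 x hx), _root_.zero_apply, zero_mul, abs_zero, indicator_of_notMem hx,
          zero_mul, mul_zero]
    -- (8) the slice inequality
    have eF4 : (∫ x, F4 (t, x)) = σ t * ∫ x, θ x * ⟪fderiv ℝ (e t) x (wt x), wt x⟫ :=
      integral_const_mul (σ t) fun x => θ x * ⟪fderiv ℝ (e t) x (wt x), wt x⟫
    have eFL : (∫ x, FL (t, x)) = σ t * ∫ x, χ x ^ 2 * frobeniusNormSq (gt x) :=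
      integral_const_mul (σ t) fun x => χ x ^ 2 * frobeniusNormSq (gt x)
    have eFs : (∫ x, Fs (t, x)) = σ t * ∫ x, χ x ^ 2 * ‖wt x‖ ^ 2 :=
      integral_const_mul (σ t) fun x => χ x ^ 2 * ‖wt x‖ ^ 2
    have eFB : (∫ x, FB (t, x)) = σ t * ∫ x in ball x₀ 3, ‖wt x‖ ^ 2 := by
      have h1 : (∫ x, FB (t, x)) = σ t * ∫ x, B.indicator (fun _ => (1 : ℝ)) x * ‖wt x‖ ^ 2 :=
        integral_const_mul (σ t) fun x => B.indicator (fun _ => (1 : ℝ)) x * ‖wt x‖ ^ 2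
      have h2 : (∫ x, B.indicator (fun _ => (1 : ℝ)) x * ‖wt x‖ ^ 2) = ∫ x in ball x₀ 3, ‖wt x‖ ^ 2 := by
        rw [← integral_indicator hBm]
        refine integral_congr_ae (ae_of_all _ fun x => ?_)
        show B.indicator (fun _ => (1 : ℝ)) x * ‖wt x‖ ^ 2 = B.indicator (fun x => ‖wt x‖ ^ 2) x
        by_cases hx : x ∈ B
        · rw [indicator_of_mem hx, indicator_of_mem hx, one_mul]
        · rw [indicator_of_notMem hx, indicator_of_notMem hx, zero_mul]
      rw [h1, h2]
    have eFeB : (∫ x, FeB (t, x)) = σ t * ∫ x, B.indicator (fun _ => (1 : ℝ)) x * (‖e t x‖ * ‖wt x‖ ^ 2) :=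
      integral_const_mul (σ t) fun x => B.indicator (fun _ => (1 : ℝ)) x * (‖e t x‖ * ‖wt x‖ ^ 2)
    have eY : Y t = ∫ x, χ x ^ 2 * ‖wt x‖ ^ 2 := rfl
    rw [eF4, eFL, eFs, eFB, eFeB, hIBP]
    have hσpos : 0 ≤ σ t := hσ_nn t
    -- with `J₁, J₂` the two terms of the integration by parts:
    set J₁ : ℝ := ∫ x, fderiv ℝ θ x (wt x) * ⟪e t x, wt x⟫ with hJ₁
    set J₂ : ℝ := ∫ x, χ x ^ 2 * ⟪gt x (wt x), e t x⟫ with hJ₂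
    set EB : ℝ := ∫ x, B.indicator (fun _ => (1 : ℝ)) x * (‖e t x‖ * ‖wt x‖ ^ 2) with hEB
    set D : ℝ := ∫ x, χ x ^ 2 * frobeniusNormSq (gt x) with hD
    set W : ℝ := ∫ x in ball x₀ 3, ‖wt x‖ ^ 2 with hW
    have key : -2 * (-J₁ - J₂) ≤ D + Y t + c₁ ^ 2 * W + 4 * c₁ * EB + K₀ * (P t * Y t) := by
      have h1 : 2 * J₁ ≤ 2 * (2 * c₁ * EB) := by linarith [le_abs_self J₁, hJ1]
      have h2 : 2 * J₂ ≤ D + Y t + c₁ ^ 2 * W + K₀ * P t * Y t := by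
        have := h2J2; rw [eY]; linarith [le_abs_self J₂]
      nlinarith [h1, h2]
    have := mul_le_mul_of_nonneg_left key hσpos
    nlinarith [this, hσpos]
  -- ### integrating the slice inequality
  have iI4 := iF4.integral_prod_left (μ := volume) (ν := volume)
  have iIL := iFL.integral_prod_left (μ := volume) (ν := volume)
  have iIs := iFs.integral_prod_left (μ := volume) (ν := volume)
  have iIB := iFB.integral_prod_left (μ := volume) (ν := volume)
  have iIeB := iFeB.integral_prod_left (μ := volume) (ν := volume)
  set Rf : ℝ → ℝ := fun t => (∫ x, FL (t, x)) + (∫ x, Fs (t, x)) + c₁ ^ 2 * (∫ x, FB (t, x)) +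
    4 * c₁ * (∫ x, FeB (t, x)) with hRf
  have iRf : Integrable Rf volume := ((iIL.add iIs).add (iIB.const_mul (c₁ ^ 2))).add (iIeB.const_mul (4 * c₁))
  have iI4' : Integrable (fun t => -2 * (∫ x, F4 (t, x))) volume := iI4.const_mul (-2)
  have hbfin : (∫⁻ t, ENNReal.ofReal (K₀ * (σ t * (P t * Y t)))) ≠ ∞ := by
    rw [show (fun t => ENNReal.ofReal (K₀ * (σ t * (P t * Y t)))) =
        fun t => ENNReal.ofReal K₀ * ENNReal.ofReal (σ t * (P t * Y t)) from
        funext fun t => ENNReal.ofReal_mul hK₀, lintegral_const_mul' _ _ ENNReal.ofReal_ne_top]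
    exact ENNReal.mul_ne_top ENNReal.ofReal_ne_top hΛfin'
  have hhyb := integral_le_toReal_lintegral_of_ae_le (μ := volume)
    (g := fun t => -2 * (∫ x, F4 (t, x)) - Rf t) (b := fun t => K₀ * (σ t * (P t * Y t)))
    (iI4'.sub iRf) (hF4_ae.mono fun t ht => by simp only [hRf]; linarith) hbfin
  have hΛeq : (∫⁻ t, ENNReal.ofReal (K₀ * (σ t * (P t * Y t)))).toReal =
      K₀ * (∫⁻ t, ENNReal.ofReal (σ t * (P t * Y t))).toReal := by
    rw [show (fun t => ENNReal.ofReal (K₀ * (σ t * (P t * Y t)))) =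
        fun t => ENNReal.ofReal K₀ * ENNReal.ofReal (σ t * (P t * Y t)) from
        funext fun t => ENNReal.ofReal_mul hK₀, lintegral_const_mul' _ _ ENNReal.ofReal_ne_top,
      ENNReal.toReal_mul, ENNReal.toReal_ofReal hK₀]
  have dF4 : (∫ t, ∫ x, F4 (t, x)) = ∫ z, F4 z := (integral_prod (μ := volume) (ν := volume) _ iF4).symm
  have dFL : (∫ t, ∫ x, FL (t, x)) = ∫ z, FL z := (integral_prod (μ := volume) (ν := volume) _ iFL).symm
  have dFs' : (∫ t, ∫ x, Fs (t, x)) = ∫ z, Fs z := (integral_prod (μ := volume) (ν := volume) _ iFs).symm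
  have dFB : (∫ t, ∫ x, FB (t, x)) = ∫ z, FB z := (integral_prod (μ := volume) (ν := volume) _ iFB).symm
  have dFeB : (∫ t, ∫ x, FeB (t, x)) = ∫ z, FeB z := (integral_prod (μ := volume) (ν := volume) _ iFeB).symm
  have s1 : (∫ t, ((∫ x, FL (t, x)) + (∫ x, Fs (t, x)))) = (∫ t, ∫ x, FL (t, x)) + ∫ t, ∫ x, Fs (t, x) :=
    integral_add iIL iIs
  have s2 : (∫ t, ((∫ x, FL (t, x)) + (∫ x, Fs (t, x)) + c₁ ^ 2 * (∫ x, FB (t, x)))) =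
      (∫ t, ((∫ x, FL (t, x)) + (∫ x, Fs (t, x)))) + ∫ t, c₁ ^ 2 * (∫ x, FB (t, x)) :=
    integral_add (iIL.add iIs) (iIB.const_mul (c₁ ^ 2))
  have s3 : (∫ t, Rf t) = (∫ t, ((∫ x, FL (t, x)) + (∫ x, Fs (t, x)) + c₁ ^ 2 * (∫ x, FB (t, x)))) +
      ∫ t, 4 * c₁ * (∫ x, FeB (t, x)) :=
    integral_add ((iIL.add iIs).add (iIB.const_mul (c₁ ^ 2))) (iIeB.const_mul (4 * c₁))
  have s4 : (∫ t, c₁ ^ 2 * (∫ x, FB (t, x))) = c₁ ^ 2 * ∫ t, ∫ x, FB (t, x) :=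
    integral_const_mul (c₁ ^ 2) fun t => ∫ x, FB (t, x)
  have s5 : (∫ t, 4 * c₁ * (∫ x, FeB (t, x))) = 4 * c₁ * ∫ t, ∫ x, FeB (t, x) :=
    integral_const_mul (4 * c₁) fun t => ∫ x, FeB (t, x)
  have s6 : (∫ t, (-2 * (∫ x, F4 (t, x)) - Rf t)) = (∫ t, -2 * (∫ x, F4 (t, x))) - ∫ t, Rf t :=
    integral_sub iI4' iRf
  have s7 : (∫ t, -2 * (∫ x, F4 (t, x))) = -2 * ∫ t, ∫ x, F4 (t, x) :=
    integral_const_mul (-2) fun t => ∫ x, F4 (t, x)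
  have hhyb' : -2 * (∫ z, F4 z) - ((∫ z, FL z) + (∫ z, Fs z) + c₁ ^ 2 * (∫ z, FB z) + 4 * c₁ * (∫ z, FeB z)) ≤
      K₀ * (∫⁻ t, ENNReal.ofReal (σ t * (P t * Y t))).toReal := by
    have := hhyb
    rw [s6, s7, s3, s2, s1, s4, s5, dF4, dFL, dFs', dFB, dFeB, hΛeq] at this
    exact this
  -- ### §10 the lower-order terms are dominated by `∫_S Ψ`
  have hScases : ∀ z : ℝ × EuclideanSpace ℝ (Fin 3), z ∉ S → z.1 ∉ Icc δ (τ - δ) ∨ z.2 ∉ B := by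
    intro z hz
    by_cases h1 : z.1 ∈ Icc δ (τ - δ)
    · exact Or.inr fun h2 => hz ⟨⟨by linarith [h1.1], by linarith [h1.2]⟩, h2⟩
    · exact Or.inl h1
  have hSK₂' : volume.restrict S ≤ volume.restrict K₂ := Measure.restrict_mono hSK₂ le_rfl
  have sW2 := gW2.mono_set hSK₂
  have sW1 := gW1.mono_set hSK₂
  have sW2U := gW2U.mono_set hSK₂
  have sPW := gPW.mono_set hSK₂
  have sU1 := gU1.mono_set hSK₂
  have sconst : ∀ c : ℝ, IntegrableOn (fun _ : ℝ × EuclideanSpace ℝ (Fin 3) => c) S volume := fun c =>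
    integrableOn_const (hs := ((measure_mono hSK₂).trans_lt hK₂c.measure_lt_top).ne)
  have smv := hvm₂.mono_measure hSK₂'
  have smπ := hπm₂.mono_measure hSK₂'
  have sme := hem₂.mono_measure hSK₂'
  have smDe := hDem₂.mono_measure hSK₂'
  have smw := hwm₂.mono_measure hSK₂'
  have hSmem : ∀ z ∈ S, z ∈ K₂ := fun z hz => hSK₂ hz
  -- the eight pieces of `Ψ` are integrable on `S`
  have iΨ1 : IntegrableOn (fun z : ℝ × EuclideanSpace ℝ (Fin 3) => cΔ * ‖v z.1 z.2 - e z.1 z.2‖ ^ 2) S volume :=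
    sW2.const_mul cΔ
  have iΨ2 : IntegrableOn (fun z : ℝ × EuclideanSpace ℝ (Fin 3) =>
      2 * c₁ * ((‖v z.1 z.2 - e z.1 z.2‖ ^ 2 + ‖e z.1 z.2‖ ^ 2) * ‖v z.1 z.2‖)) S volume := by
    refine Integrable.mono' ((sW2U.add (sU1.const_mul (Ce ^ 2))).const_mul (2 * c₁))
      ((((smw.norm.pow 2).add (sme.norm.pow 2)).mul smv.norm).const_mul _)
      ((ae_restrict_iff' hSm).2 (Eventually.of_forall fun z hz => ?_))
    rw [Real.norm_eq_abs, abs_of_nonneg (by positivity)]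
    simp only [Pi.add_apply]
    have h1 : ‖e z.1 z.2‖ ^ 2 ≤ Ce ^ 2 := pow_le_pow_left₀ (norm_nonneg _) (heb z (hSmem z hz)) 2
    have h0 : 0 ≤ ‖v z.1 z.2‖ := norm_nonneg _
    nlinarith [mul_le_mul_of_nonneg_right h1 h0, sq_nonneg ‖v z.1 z.2 - e z.1 z.2‖]
  have iΨ3 : IntegrableOn (fun z : ℝ × EuclideanSpace ℝ (Fin 3) =>
      4 * c₁ * (|π z.1 z.2| * ‖v z.1 z.2 - e z.1 z.2‖)) S volume := sPW.const_mul _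
  have iΨ4 : IntegrableOn (fun z : ℝ × EuclideanSpace ℝ (Fin 3) =>
      2 * (‖fderiv ℝ (e z.1) z.2‖ * ‖e z.1 z.2‖ * ‖v z.1 z.2 - e z.1 z.2‖)) S volume := by
    refine Integrable.mono' ((sW1.const_mul (CDe * Ce)).const_mul 2)
      (((smDe.norm.mul sme.norm).mul smw.norm).const_mul _)
      ((ae_restrict_iff' hSm).2 (Eventually.of_forall fun z hz => ?_))
    rw [Real.norm_eq_abs, abs_of_nonneg (by positivity)]
    have := mul_le_mul (hDeb z (hSmem z hz)) (heb z (hSmem z hz)) (norm_nonneg _) hCDe0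
    have h0 := norm_nonneg (v z.1 z.2 - e z.1 z.2)
    nlinarith [mul_le_mul_of_nonneg_right this h0]
  have iΨ5 : IntegrableOn (fun z : ℝ × EuclideanSpace ℝ (Fin 3) =>
      2 * c₁ * (‖e z.1 z.2‖ ^ 2 * ‖v z.1 z.2 - e z.1 z.2‖)) S volume := by
    refine Integrable.mono' ((sW1.const_mul (Ce ^ 2)).const_mul (2 * c₁))
      (((sme.norm.pow 2).mul smw.norm).const_mul _)
      ((ae_restrict_iff' hSm).2 (Eventually.of_forall fun z hz => ?_))
    rw [Real.norm_eq_abs, abs_of_nonneg (by positivity)]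
    have h1 : ‖e z.1 z.2‖ ^ 2 ≤ Ce ^ 2 := pow_le_pow_left₀ (norm_nonneg _) (heb z (hSmem z hz)) 2
    have h0 := norm_nonneg (v z.1 z.2 - e z.1 z.2)
    nlinarith [mul_le_mul_of_nonneg_right h1 h0]
  have iΨ6 : IntegrableOn (fun z : ℝ × EuclideanSpace ℝ (Fin 3) => 2 * c₁ * ‖e z.1 z.2‖ ^ 3) S volume := by
    refine Integrable.mono' (sconst (2 * c₁ * Ce ^ 3)) ((sme.norm.pow 3).const_mul _)
      ((ae_restrict_iff' hSm).2 (Eventually.of_forall fun z hz => ?_))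
    rw [Real.norm_eq_abs, abs_of_nonneg (by positivity)]
    have h1 : ‖e z.1 z.2‖ ^ 3 ≤ Ce ^ 3 := pow_le_pow_left₀ (norm_nonneg _) (heb z (hSmem z hz)) 3
    nlinarith
  have iΨ7 : IntegrableOn (fun z : ℝ × EuclideanSpace ℝ (Fin 3) =>
      4 * c₁ * (‖e z.1 z.2‖ * ‖v z.1 z.2 - e z.1 z.2‖ ^ 2)) S volume := by
    refine Integrable.mono' ((sW2.const_mul Ce).const_mul (4 * c₁)) ((sme.norm.mul (smw.norm.pow 2)).const_mul _)
      ((ae_restrict_iff' hSm).2 (Eventually.of_forall fun z hz => ?_))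
    rw [Real.norm_eq_abs, abs_of_nonneg (by positivity)]
    have h1 := heb z (hSmem z hz)
    have h0 := sq_nonneg ‖v z.1 z.2 - e z.1 z.2‖
    nlinarith [mul_le_mul_of_nonneg_right h1 h0]
  have iΨ8 : IntegrableOn (fun z : ℝ × EuclideanSpace ℝ (Fin 3) => c₁ ^ 2 * ‖v z.1 z.2 - e z.1 z.2‖ ^ 2) S volume :=
    sW2.const_mul _
  -- vanishing of the integrands off `S`
  have zS : ∀ z : ℝ × EuclideanSpace ℝ (Fin 3), z ∉ S →
      σ z.1 = 0 ∨ (θ z.2 = 0 ∧ gradient θ z.2 = 0 ∧ (Δ θ) z.2 = 0 ∧ B.indicator (fun _ => (1 : ℝ)) z.2 = 0) := by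
    intro z hz
    rcases hScases z hz with h1 | h2
    · exact Or.inl (hσK _ h1)
    · have h2' : z.2 ∉ closedBall x₀ 2 := fun h' => h2 (closedBall_subset_ball (by norm_num) h')
      exact Or.inr ⟨hθz _ h2', hgθz _ h2', hΔθz _ h2', indicator_of_notMem h2 _⟩
  -- the bounds
  have bΨ1 : (∫ z, F1 z) ≤ ∫ z in S, cΔ * ‖v z.1 z.2 - e z.1 z.2‖ ^ 2 := by
    refine integral_le_setIntegral_of_abs_le hSm iF1 iΨ1 (fun z hz => ?_) (fun z hz => ?_)
    · rcases zS z hz with h1 | ⟨-, -, h3, -⟩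
      · simp only [hF1, h1, zero_mul]
      · simp only [hF1, h3, mul_zero]
    · simp only [hF1, abs_mul, abs_of_nonneg (sq_nonneg ‖v z.1 z.2 - e z.1 z.2‖)]
      calc |σ z.1| * (‖v z.1 z.2 - e z.1 z.2‖ ^ 2 * |(Δ θ) z.2|) ≤ 1 * (‖v z.1 z.2 - e z.1 z.2‖ ^ 2 * cΔ) := by
            gcongr
            · exact hσb z.1
            · exact hΔθ z.2
        _ = cΔ * ‖v z.1 z.2 - e z.1 z.2‖ ^ 2 := by ring
  have bΨ2 : (∫ z, F2 z) ≤ ∫ z in S, 2 * c₁ * ((‖v z.1 z.2 - e z.1 z.2‖ ^ 2 + ‖e z.1 z.2‖ ^ 2) * ‖v z.1 z.2‖) := by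
    refine integral_le_setIntegral_of_abs_le hSm iF2 iΨ2 (fun z hz => ?_) (fun z hz => ?_)
    · rcases zS z hz with h1 | ⟨-, h2, -, -⟩
      · simp only [hF2, h1, zero_mul]
      · simp only [hF2, h2, inner_zero_right, mul_zero]
    · simp only [hF2, abs_mul]
      have h1 : |‖v z.1 z.2 - e z.1 z.2‖ ^ 2 - ‖e z.1 z.2‖ ^ 2| ≤ ‖v z.1 z.2 - e z.1 z.2‖ ^ 2 + ‖e z.1 z.2‖ ^ 2 := by
        refine (abs_sub _ _).trans ?_
        rw [abs_of_nonneg (sq_nonneg ‖v z.1 z.2 - e z.1 z.2‖), abs_of_nonneg (sq_nonneg ‖e z.1 z.2‖)]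
      have h2 := hgradθ z.2 (v z.1 z.2)
      calc |σ z.1| * (|‖v z.1 z.2 - e z.1 z.2‖ ^ 2 - ‖e z.1 z.2‖ ^ 2| * |⟪v z.1 z.2, gradient θ z.2⟫|)
          ≤ 1 * ((‖v z.1 z.2 - e z.1 z.2‖ ^ 2 + ‖e z.1 z.2‖ ^ 2) * (2 * c₁ * ‖v z.1 z.2‖)) := by
            gcongr
            exact hσb z.1
        _ = 2 * c₁ * ((‖v z.1 z.2 - e z.1 z.2‖ ^ 2 + ‖e z.1 z.2‖ ^ 2) * ‖v z.1 z.2‖) := by ring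
  have bΨ3 : 2 * (∫ z, F3 z) ≤ ∫ z in S, 4 * c₁ * (|π z.1 z.2| * ‖v z.1 z.2 - e z.1 z.2‖) := by
    have h1 : (∫ z, F3 z) ≤ ∫ z in S, 2 * c₁ * (|π z.1 z.2| * ‖v z.1 z.2 - e z.1 z.2‖) := by
      refine integral_le_setIntegral_of_abs_le hSm iF3 (sPW.const_mul _) (fun z hz => ?_) (fun z hz => ?_)
      · rcases zS z hz with h1 | ⟨-, h2, -, -⟩
        · simp only [hF3, h1, zero_mul]
        · simp only [hF3, h2, inner_zero_right, mul_zero]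
      · simp only [hF3, abs_mul]
        have h2 := hgradθ z.2 (v z.1 z.2 - e z.1 z.2)
        calc |σ z.1| * (|π z.1 z.2| * |⟪v z.1 z.2 - e z.1 z.2, gradient θ z.2⟫|)
            ≤ 1 * (|π z.1 z.2| * (2 * c₁ * ‖v z.1 z.2 - e z.1 z.2‖)) := by
              gcongr
              exact hσb z.1
          _ = 2 * c₁ * (|π z.1 z.2| * ‖v z.1 z.2 - e z.1 z.2‖) := by ring
    have h2 : (∫ z in S, 4 * c₁ * (|π z.1 z.2| * ‖v z.1 z.2 - e z.1 z.2‖)) =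
        2 * ∫ z in S, 2 * c₁ * (|π z.1 z.2| * ‖v z.1 z.2 - e z.1 z.2‖) := by
      rw [← integral_const_mul]
      refine integral_congr_ae (ae_of_all _ fun z => ?_); ring
    rw [h2]; linarith
  have bΨ4 : -2 * (∫ z, F5 z) ≤ ∫ z in S, 2 * (‖fderiv ℝ (e z.1) z.2‖ * ‖e z.1 z.2‖ * ‖v z.1 z.2 - e z.1 z.2‖) := by
    have hneg : Integrable (fun z => -F5 z) volume := iF5.neg
    have h1 : (∫ z, -F5 z) ≤ ∫ z in S, ‖fderiv ℝ (e z.1) z.2‖ * ‖e z.1 z.2‖ * ‖v z.1 z.2 - e z.1 z.2‖ := by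
      refine integral_le_setIntegral_of_abs_le hSm hneg ?_ (fun z hz => ?_) (fun z hz => ?_)
      · refine Integrable.mono' (sW1.const_mul (CDe * Ce)) ((smDe.norm.mul sme.norm).mul smw.norm)
          ((ae_restrict_iff' hSm).2 (Eventually.of_forall fun z hz => ?_))
        rw [Real.norm_eq_abs, abs_of_nonneg (by positivity)]
        have := mul_le_mul (hDeb z (hSmem z hz)) (heb z (hSmem z hz)) (norm_nonneg _) hCDe0
        exact mul_le_mul_of_nonneg_right this (norm_nonneg _)
      · rcases zS z hz with h1 | ⟨h2, -, -, -⟩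
        · simp only [hF5, h1, zero_mul, neg_zero]
        · simp only [hF5, h2, zero_mul, mul_zero, neg_zero]
      · simp only [hF5, abs_neg, abs_mul]
        have h1 : |⟪fderiv ℝ (e z.1) z.2 (e z.1 z.2), v z.1 z.2 - e z.1 z.2⟫| ≤
            ‖fderiv ℝ (e z.1) z.2‖ * ‖e z.1 z.2‖ * ‖v z.1 z.2 - e z.1 z.2‖ :=
          (abs_real_inner_le_norm _ _).trans (mul_le_mul_of_nonneg_right (ContinuousLinearMap.le_opNorm _ _)
            (norm_nonneg _))
        calc |σ z.1| * (|θ z.2| * |⟪fderiv ℝ (e z.1) z.2 (e z.1 z.2), v z.1 z.2 - e z.1 z.2⟫|)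
            ≤ 1 * (1 * (‖fderiv ℝ (e z.1) z.2‖ * ‖e z.1 z.2‖ * ‖v z.1 z.2 - e z.1 z.2‖)) := by
              gcongr
              · exact hσb z.1
              · exact hθabs z.2
          _ = _ := by ring
    have h2 : (∫ z in S, 2 * (‖fderiv ℝ (e z.1) z.2‖ * ‖e z.1 z.2‖ * ‖v z.1 z.2 - e z.1 z.2‖)) =
        2 * ∫ z in S, ‖fderiv ℝ (e z.1) z.2‖ * ‖e z.1 z.2‖ * ‖v z.1 z.2 - e z.1 z.2‖ := integral_const_mul _ _
    rw [integral_neg] at h1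
    rw [h2]; linarith
  have bΨ5 : (∫ z, F6 z) ≤ ∫ z in S, 2 * c₁ * (‖e z.1 z.2‖ ^ 2 * ‖v z.1 z.2 - e z.1 z.2‖) := by
    refine integral_le_setIntegral_of_abs_le hSm iF6 iΨ5 (fun z hz => ?_) (fun z hz => ?_)
    · rcases zS z hz with h1 | ⟨-, h2, -, -⟩
      · simp only [hF6, h1, zero_mul]
      · simp only [hF6, h2, inner_zero_right, mul_zero]
    · simp only [hF6, abs_mul, abs_of_nonneg (sq_nonneg ‖e z.1 z.2‖)]
      have h2 := hgradθ z.2 (v z.1 z.2 - e z.1 z.2)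
      calc |σ z.1| * (‖e z.1 z.2‖ ^ 2 * |⟪v z.1 z.2 - e z.1 z.2, gradient θ z.2⟫|)
          ≤ 1 * (‖e z.1 z.2‖ ^ 2 * (2 * c₁ * ‖v z.1 z.2 - e z.1 z.2‖)) := by
            gcongr
            exact hσb z.1
        _ = 2 * c₁ * (‖e z.1 z.2‖ ^ 2 * ‖v z.1 z.2 - e z.1 z.2‖) := by ring
  have bΨ6 : (∫ z, F7 z) ≤ ∫ z in S, 2 * c₁ * ‖e z.1 z.2‖ ^ 3 := by
    refine integral_le_setIntegral_of_abs_le hSm iF7 iΨ6 (fun z hz => ?_) (fun z hz => ?_)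
    · rcases zS z hz with h1 | ⟨-, h2, -, -⟩
      · simp only [hF7, h1, zero_mul]
      · simp only [hF7, h2, inner_zero_right, zero_mul, mul_zero]
    · simp only [hF7, abs_mul, abs_of_nonneg (sq_nonneg ‖e z.1 z.2‖)]
      have h2 := hgradθ z.2 (e z.1 z.2)
      calc |σ z.1| * (|⟪e z.1 z.2, gradient θ z.2⟫| * ‖e z.1 z.2‖ ^ 2)
          ≤ 1 * ((2 * c₁ * ‖e z.1 z.2‖) * ‖e z.1 z.2‖ ^ 2) := by
            gcongr
            exact hσb z.1
        _ = 2 * c₁ * ‖e z.1 z.2‖ ^ 3 := by ring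
  have bΨ7 : 4 * c₁ * (∫ z, FeB z) ≤ ∫ z in S, 4 * c₁ * (‖e z.1 z.2‖ * ‖v z.1 z.2 - e z.1 z.2‖ ^ 2) := by
    have h1 : (∫ z, FeB z) ≤ ∫ z in S, ‖e z.1 z.2‖ * ‖v z.1 z.2 - e z.1 z.2‖ ^ 2 := by
      refine integral_le_setIntegral_of_abs_le hSm iFeB ?_ (fun z hz => ?_) (fun z hz => ?_)
      · refine Integrable.mono' (sW2.const_mul Ce) (sme.norm.mul (smw.norm.pow 2))
          ((ae_restrict_iff' hSm).2 (Eventually.of_forall fun z hz => ?_))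
        rw [Real.norm_eq_abs, abs_of_nonneg (by positivity)]
        exact mul_le_mul_of_nonneg_right (heb z (hSmem z hz)) (sq_nonneg _)
      · rcases zS z hz with h1 | ⟨-, -, -, h4⟩
        · simp only [hFeB, h1, zero_mul]
        · simp only [hFeB, h4, zero_mul, mul_zero]
      · simp only [hFeB, abs_mul, abs_of_nonneg (sq_nonneg ‖v z.1 z.2 - e z.1 z.2‖), abs_norm]
        calc |σ z.1| * (|B.indicator (fun _ => (1 : ℝ)) z.2| * (‖e z.1 z.2‖ * ‖v z.1 z.2 - e z.1 z.2‖ ^ 2))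
            ≤ 1 * (1 * (‖e z.1 z.2‖ * ‖v z.1 z.2 - e z.1 z.2‖ ^ 2)) := by
              gcongr
              · exact hσb z.1
              · exact hind_le z.2
          _ = _ := by ring
    have h2 : (∫ z in S, 4 * c₁ * (‖e z.1 z.2‖ * ‖v z.1 z.2 - e z.1 z.2‖ ^ 2)) =
        4 * c₁ * ∫ z in S, ‖e z.1 z.2‖ * ‖v z.1 z.2 - e z.1 z.2‖ ^ 2 := integral_const_mul _ _
    rw [h2]
    exact mul_le_mul_of_nonneg_left h1 (by positivity)
  have bΨ8 : c₁ ^ 2 * (∫ z, FB z) ≤ ∫ z in S, c₁ ^ 2 * ‖v z.1 z.2 - e z.1 z.2‖ ^ 2 := by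
    have h1 : (∫ z, FB z) ≤ ∫ z in S, ‖v z.1 z.2 - e z.1 z.2‖ ^ 2 := by
      refine integral_le_setIntegral_of_abs_le hSm iFB sW2 (fun z hz => ?_) (fun z hz => ?_)
      · rcases zS z hz with h1 | ⟨-, -, -, h4⟩
        · simp only [hFB, h1, zero_mul]
        · simp only [hFB, h4, zero_mul, mul_zero]
      · simp only [hFB, abs_mul, abs_of_nonneg (sq_nonneg ‖v z.1 z.2 - e z.1 z.2‖)]
        calc |σ z.1| * (|B.indicator (fun _ => (1 : ℝ)) z.2| * ‖v z.1 z.2 - e z.1 z.2‖ ^ 2)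
            ≤ 1 * (1 * ‖v z.1 z.2 - e z.1 z.2‖ ^ 2) := by
              gcongr
              · exact hσb z.1
              · exact hind_le z.2
          _ = _ := by ring
    have h2 : (∫ z in S, c₁ ^ 2 * ‖v z.1 z.2 - e z.1 z.2‖ ^ 2) = c₁ ^ 2 * ∫ z in S, ‖v z.1 z.2 - e z.1 z.2‖ ^ 2 :=
      integral_const_mul _ _
    rw [h2]
    exact mul_le_mul_of_nonneg_left h1 (sq_nonneg _)
  -- the sum of the pieces is `∫_S Ψ`: partial sums are integrable
  have iS2 : IntegrableOn (fun z : ℝ × EuclideanSpace ℝ (Fin 3) =>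
        cΔ * ‖v z.1 z.2 - e z.1 z.2‖ ^ 2 +
        2 * c₁ * ((‖v z.1 z.2 - e z.1 z.2‖ ^ 2 + ‖e z.1 z.2‖ ^ 2) * ‖v z.1 z.2‖)) S volume := iΨ1.add iΨ2
  have iS3 : IntegrableOn (fun z : ℝ × EuclideanSpace ℝ (Fin 3) =>
        cΔ * ‖v z.1 z.2 - e z.1 z.2‖ ^ 2 +
        2 * c₁ * ((‖v z.1 z.2 - e z.1 z.2‖ ^ 2 + ‖e z.1 z.2‖ ^ 2) * ‖v z.1 z.2‖) +
        4 * c₁ * (|π z.1 z.2| * ‖v z.1 z.2 - e z.1 z.2‖)) S volume := iS2.add iΨ3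
  have iS4 : IntegrableOn (fun z : ℝ × EuclideanSpace ℝ (Fin 3) =>
        cΔ * ‖v z.1 z.2 - e z.1 z.2‖ ^ 2 +
        2 * c₁ * ((‖v z.1 z.2 - e z.1 z.2‖ ^ 2 + ‖e z.1 z.2‖ ^ 2) * ‖v z.1 z.2‖) +
        4 * c₁ * (|π z.1 z.2| * ‖v z.1 z.2 - e z.1 z.2‖) +
        2 * (‖fderiv ℝ (e z.1) z.2‖ * ‖e z.1 z.2‖ * ‖v z.1 z.2 - e z.1 z.2‖)) S volume := iS3.add iΨ4
  have iS5 : IntegrableOn (fun z : ℝ × EuclideanSpace ℝ (Fin 3) =>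
        cΔ * ‖v z.1 z.2 - e z.1 z.2‖ ^ 2 +
        2 * c₁ * ((‖v z.1 z.2 - e z.1 z.2‖ ^ 2 + ‖e z.1 z.2‖ ^ 2) * ‖v z.1 z.2‖) +
        4 * c₁ * (|π z.1 z.2| * ‖v z.1 z.2 - e z.1 z.2‖) +
        2 * (‖fderiv ℝ (e z.1) z.2‖ * ‖e z.1 z.2‖ * ‖v z.1 z.2 - e z.1 z.2‖) +
        2 * c₁ * (‖e z.1 z.2‖ ^ 2 * ‖v z.1 z.2 - e z.1 z.2‖)) S volume := iS4.add iΨ5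
  have iS6 : IntegrableOn (fun z : ℝ × EuclideanSpace ℝ (Fin 3) =>
        cΔ * ‖v z.1 z.2 - e z.1 z.2‖ ^ 2 +
        2 * c₁ * ((‖v z.1 z.2 - e z.1 z.2‖ ^ 2 + ‖e z.1 z.2‖ ^ 2) * ‖v z.1 z.2‖) +
        4 * c₁ * (|π z.1 z.2| * ‖v z.1 z.2 - e z.1 z.2‖) +
        2 * (‖fderiv ℝ (e z.1) z.2‖ * ‖e z.1 z.2‖ * ‖v z.1 z.2 - e z.1 z.2‖) +
        2 * c₁ * (‖e z.1 z.2‖ ^ 2 * ‖v z.1 z.2 - e z.1 z.2‖) +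
        2 * c₁ * ‖e z.1 z.2‖ ^ 3) S volume := iS5.add iΨ6
  have iS7 : IntegrableOn (fun z : ℝ × EuclideanSpace ℝ (Fin 3) =>
        cΔ * ‖v z.1 z.2 - e z.1 z.2‖ ^ 2 +
        2 * c₁ * ((‖v z.1 z.2 - e z.1 z.2‖ ^ 2 + ‖e z.1 z.2‖ ^ 2) * ‖v z.1 z.2‖) +
        4 * c₁ * (|π z.1 z.2| * ‖v z.1 z.2 - e z.1 z.2‖) +
        2 * (‖fderiv ℝ (e z.1) z.2‖ * ‖e z.1 z.2‖ * ‖v z.1 z.2 - e z.1 z.2‖) +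
        2 * c₁ * (‖e z.1 z.2‖ ^ 2 * ‖v z.1 z.2 - e z.1 z.2‖) +
        2 * c₁ * ‖e z.1 z.2‖ ^ 3 +
        4 * c₁ * (‖e z.1 z.2‖ * ‖v z.1 z.2 - e z.1 z.2‖ ^ 2)) S volume := iS6.add iΨ7
  -- ### §11 conclusion
  have hL0 : 0 ≤ ∫ z, FL z := integral_nonneg fun z =>
    mul_nonneg (hσ_nn _) (mul_nonneg (hθ0 _) (frobeniusNormSq_nonneg _))
  rw [integral_add iS7 iΨ8, integral_add iS6 iΨ7, integral_add iS5 iΨ6, integral_add iS4 iΨ5,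
    integral_add iS3 iΨ4, integral_add iS2 iΨ3, integral_add iΨ1 iΨ2]
  rw [vFd] at h5
  rw [vFs] at hhyb'
  linarith [h5, hhyb', bΨ1, bΨ2, bΨ3, bΨ4, bΨ5, bΨ6, bΨ7, bΨ8, hL0]

end IsLocalLeraySolutionOn

end Literature.Analysis.FluidPDE

end
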